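import Literature.MathematicalPhysics.QuantumFieldTheory.Balaban1983to89.T4FlagMemoryTwoRun

/-!
# `Balaban1983to89.T4FlagMemoryAF` — NE4 (node U2 of the T⁴ uniqueness spine) with a COUPLING-WEIGHTED one-step
memory: the window of `T4FlagMemory` in the γ-currency (box-uniform), a forward-envelope discrete Grönwall bound
with step-dependent memory constants (run-wise; its tail corollaries concern NON-INCREASING runs — NOT the orientation
of the tree's asymptotically free runs, see the ORIENTATION paragraph of (ii) below, v1.1), and (v1.1, §9) the
γ-currency read on the INFRARED-PINNED runs of (0.20) as a currency in the renormalized coupling g itself.  HYPOTHESIS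
SHAPES + BOOKKEEPING + a located [analysis] reading; nothing about Bałaban's objects is asserted.

HONEST FRAMING (cell `pub-balaban`, T4-DAG PAGE 1).  The cell's T4 target is rung (B)+1 — existence AND uniqueness of
the ε → 0 limit of Bałaban's unit-scale averaged expectations on a FIXED finite torus; NOT infinite volume, NOT a mass
gap, NOT the Clay problem, NOT summit progress.  This module is the fourth leaf of the lineage `b2b-balaban-t4-ne4-p1`
(technique: discrete Grönwall / fading-memory recursion) for spine estimate NE4 = node U2 ("η-rate of the full β_k":
`T4CouplingMatching.ScaleShiftRate` + `HistLipschitz` with `FadingMemory`, K-uniform).  `T4FlagMemory` reduced NE4,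
for any β-family generated by an iterated one-step map, to FOUR one-step inputs and ONE smallness `(1 + C′)ω < ρ`
(window I6 of the cell's booking sheet), `C′` = the functional-memory constant of `StepMemory`/`FadingMemory`; its §4
located `C′ω = κ = c′K₁ε₁` (ε₁-currency) for the CARRIED small-field variant of [II].  THIS module types the finer
shape that the UNCARRIED variant of [II] p. 8 suggests — a memory constant PROPORTIONAL TO THE COUPLING AT WHICH THE
STEP IS TAKEN, `StepMemoryFn Φ γ (fun g ↦ c·g) ω` — and proves: (i) box-uniformly it feeds `T4FlagMemory`'s and
`T4FlagMemoryTwoRun`'s theorems with `C′ = cγ` (the sup over the box ]0,γ]), so window I6 reads `(1 + cγ)ω < ρ` — a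
smallness of γ (§3) —, which print's own p. 18 assumption converts into an ε₁-TYPE smallness (§4); (ii) run-wise, a
FORWARD-ENVELOPE discrete Grönwall inequality (§5–§6) with STEP-DEPENDENT memory constants dominated from the birth
index on; along NON-INCREASING, eventually small coupling runs it bounds the scale shift and the two-history modulus at
ANY rate `(1 + ε)ω` above the bare age weight `ω` (= L⁻¹ in print's currency), the early scales costing the constant
`(1 + cγ)^{n₀}`.  ORIENTATION (v1.1; referee objection G-t4r3-1 of t4-ref3-g5, kernel witness
`hmono_incompatible_with_AF` in its `AFTwin.lean`, reproduced below as `lt_succ_of_rgEqH_lower` /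
`not_antitone_of_rgEqH_lower`): in the tree's convention index 0 is the FINEST coupling and `FlowStep.RGEqH` reads
`1/g_k² = 1/g_{k+1}² + β_k`, so every run of (0.20) with `β ≥ b > 0` on the boxes (the cell's asymptotic-freedom input
T09.F / `EventualLowerH b`) is STRICTLY INCREASING towards the infrared pin `g_K = g`; the non-increasing corollaries
`sh_le_of_af_tail` / `dist_entry_le_of_af_tail` of §6 are TRUE AS TYPED but their hypothesis set is EMPTY on the
tree's asymptotically free runs, and v1's label «AF tail» for them was a MIS-ORIENTATION, withdrawn (decl names kept
for stability).  What the birth-indexed envelope DOES give on the tree's runs is §9 (v1.1): under the mere SIGN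
`β ≥ 0` a run is non-decreasing, so a run pinned at `g_K = gIR` lies in ]0, gIR] — the lower half of (0.31) of [I]
Thm 2 p. 259, «1/g² + β log(L^kε)^{−1} ≤ 1/g_k²» — and every γ-currency statement of §3/§6 holds with `γ ↦ gIR`:
memory gap `(1 + c·gIR)ω < ρ`, gain window `cr·ℓ′·gIR³·κ ≤ (1−ρ)/2`, i.e. windows in the RENORMALIZED COUPLING g,
print's own small parameter (Thm 2 p. 259: «for a sufficiently small positive g»).  The finer ultraviolet-sparse
reading (memory constants `c·g_j ≤ ε` at all but boundedly many steps of an AF run, gap `(1 + ε)ω < ρ` for every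
ε > 0) needs a STEP-indexed envelope and is the sibling lineage t4-ne4-p2's (`T4TwoRunAfTail`, journal CLAIMS.log
l.49848); it is neither proved nor imported here.  VALUE = (a) the kernel fact that node U2's window I6 is a condition on the SUP OVER THE BOX of the
one-step memory constant and on nothing else, with the clamp making "memory at admissible couplings only" the official
hypothesis; (b) the located reading, with first-hand page references, of where [II] offers the coupling weight and
what it costs; (c) non-vacuity. NOT an estimate on Bałaban's (2.13).

WHAT PRINT SAYS (read by THIS seat as images on the ×2 journal-page renders
`b2b-balaban-ref1/pages/1988-cmp116-rg-II-cluster/1988-cmp116-rg-II-cluster-pNNN-x2.png` (PDF page = journal page of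
[II]) and `…/1987-cmp109-rg-I-small-field/…-p018-x2.png`, `…-p020-x2.png` (pp. 266, 268 of [I]); the manuscripts are
UNDER ADJUDICATION and are quoted for what they STATE, never as establishing a disputed step):
* [II] p. 6: (1.19) *"B′ = g_kCB − hD̃(g_kCB)"*; (1.20) *"|B′| ≤ O(1)g_k|B| + 4C₂(O(1)g_k|B|)² ≤ C₁g_k|B| < C₁ε₁,
  where C₁ is an absolute constant, and g_k|B| < ε₁"*; *"H_k(s(Y₀), B′) is an analytic function of s(Y₀), B, for
  |s(Y₀)| ≤ e^{κ₁} and g_k|B| < ε₁"*.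
* [II] pp. 7–8: (1.21) *"|H_k(s(Y₀), B′)| ≤ 4B₀C₁e^{16κ₁}g_k|B| < 4B₀C₁e^{16κ₁}ε₁"*; (1.22) *"1/|t_□| =
  8B₀C₁e^{16κ₁}α₂⁻¹g_k|B| < 8B₀C₁e^{16κ₁}α₂⁻¹ε₁"*; the bound (1.24) of each term (1.23) of the fluctuation-field
  action: *"≤ 8B₀C₁e^{16κ₁}α₂⁻¹g_k|B|E₀(α₁/α₃)⁵(L^jη)⁵exp(−(κ₁−1)M⁻⁴|Y₀∖□̃⁴|)exp(−κd_j(X))"* — LINEAR in the size `E₀`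
  of the old term ((1.18)), with the factor `g_k|B|` (CURRENT coupling × fluctuation field) and the age factor `L^jη`
  VERBATIM — and *"By the construction it depends on U, J restricted to Y₀ ∪ □₀ = Y"*; p. 8: (1.26), *"This yields
  (6L)⁴L^jη, and the sum over j is bounded by 2(6L)⁴"*, the resummed bound (1.29) *"|Σ(1.23)| ≤
  E₀ε₁O(M^q)expO(1)κ₁exp(−(1/16)κ₁d_k(Y))"* and the remark *"Another possibility is to use the expression g_k|B|
  instead of ε₁. It gives a better bound, but the above is simpler."*
* [II] p. 9, Lemma 1: (1.33) *"E_k(U_k(exp iB′V^{(k)})) − E_k(U_k(V^{(k)})) = Σ_{Y∈D_k}V′_k(Y, U_{k+1}, B)"*, V′_k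
  analytic on (1.34) *"U^c_{k+1}(Y, (1+β)α₀, (1+β)α₁, α₀) × {B: |B| < ε₁g_k⁻¹ on Y}"*, *"it depends on configurations
  U, J, B restricted to the interior of Y"*, and (1.36) *"|V′_k(Y, U, J, B)| ≤ E₀ε₁C₁M^q expC₂κ₁
  exp(−(1−2δ)κd_k(Y))"*.
* [II] pp. 16–21 (§2, the cluster expansion of the fluctuation integral): p. 16 *"We take a small, positive number α₄,
  to be chosen later"*, (2.18) *"1/|τ(Y)| = E₀ε₁C₁α₄⁻¹M^q expC₂κ₁ exp(−(1−3δ)κd_k(Y))"*, (2.20)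
  *"Σ_{Y∈D}|τ(Y)||V_k(Y,B)| ≤ ½Σ_{b,b′⊂Y₀}α₄M⁻⁴exp(−(1/16)(κ₁−1)M⁻¹|b₋−b′₋|)|B(b)||B(b′)| + Σ_{Y∈D}α₄exp(−δκd_k(Y)) ≤
  ½O(1)α₄Σ_{b⊂Y₀}|B(b)|² + O(1)α₄M⁻⁴|Y₀|"*; p. 17 *"α₅ = O(1)e^{−1/3δ₀M} + O(α₀+α₁) + O(1)α₄ + γ₂"*; p. 18 *"Assuming
  2E₀ε₁C₁α₄⁻¹α₆⁻¹M^q expC₂κ₁ exp5κ ≤ 1"*, (2.31) *"for g_k², i.e. γ² sufficiently small, depending on M and κ"* and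
  *"Assuming (1/20)γ₂ε₁²/g_k² ≥ (1/20)γ₂ε₁²/γ² ≥ 4κ"*; p. 19 *"denoting ε₂ = 2E₀ε₁C₁α₄⁻¹α₆⁻¹M^q expC₂κ₁"*, *"We have
  used the assumption ε₂ ≤ 1"*; p. 20 *"(LM)⁴α₀, (LM)⁴α₁, (LM)⁴α₄, (LM)⁴γ₂ are bounded by a constant independent of M,
  for example by 1"*, *"C₃ = 2(L+2)⁴O(1)2E₀C₁α₄⁻¹α₆⁻¹M^q expC₂κ₁"*, Lemma 3 (2.38) *"|H(Z)| ≤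
  C₃ε₁exp(−(1−8δ)½Lκd_{k+1}(Z))"*; p. 21 (2.41) *"|E^{(k+1)}(X)| ≤ O(1)C₃ε₁exp(−(1−10δ)½Lκd_{k+1}(X))"*, *"(1−10δ)½L =
  1"*, *"we assume that O(1)C₃ε₁ ≤ ½E₀. In fact this assumption is unessential, because the constant C₃ε₁ is small
  anyway, and we can take E₀ such, that the assumption is satisfied"*.
* [I] p. 266: (2.9) *"χ_k = ∏_{b∈T^{(k)}∖{b₀(c)}}χ({|B′(b)| < ε₁})"* and *"Another possibility is to take g_k/γ_k ε₁
  instead of ε₁, where γ_k = C log(L^kε)⁻¹"*; p. 268 (2.12)–(2.13): the new entry *"E^{(k+1)}(g_k, U_{k+1}) =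
  log∫dμ_{C^{(k)}}(B)χ_k exp[P^{(k)}(g_k, U_{k+1}, B) + {…}]"* with the curly bracket *"{E_k(U_k(exp i[g_kCB −
  hD̃(g_kCB)]V^{(k)})) − E_k(U_k(V^{(k)}))}"*, which *"vanishes at g_k = 0"*. STRUCTURAL / [analysis] READING used
  below (every step labelled; NONE of it is a printed statement; the located device is p. 8's remark + p. 16's free
  constant α₄ + p. 18's γ-versus-ε₁ assumption; steps (A)–(C) agree with the cell cross-read `t4/T4-XREAD-U2R2.md`
  (Q10)–(Q21), §3(i), step (D) is this seat's):
(A) [structural] the old terms E^{(j)} enter the new entry ONLY through the curly bracket of (2.12), i.e. through V′_k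
  of Lemma 1, which is LINEAR in them ((1.33) is a difference of two evaluations of the sum of the old terms; (1.24)
  is linear in the size E₀ of the old term), and each term (1.23) vanishes at B = 0 ((1.19), (1.21)).
(B) [analysis] hence on the polydisc (1.34) the size bound (1.36) upgrades, by the Schwarz lemma in the scaling
  variable of B, to `|V′_k(Y,B)| ≤ (g_k‖B‖_{∞,Y}/ε₁)·E₀ε₁C₁M^qe^{C₂κ₁}e^{−(1−2δ)κd_k(Y)}` — print's *"use the
  expression g_k|B| instead of ε₁"*; the j-th old term's share carries the age factor `L^jη` of (1.24)/(1.26).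
(C) [analysis — the CARRIED currency, the reading behind `T4FlagMemory` §4 / cell certificate G-b12g8-2] perturbing
  one old term within its (1.18)-ball and running §2 of [II] with the budget ε₂ doubled gives a one-step memory
  modulus `≲ c‴ε₁·L^{−(k−j)}` — order 0 in g_k, currency ε₁.
(D) [analysis — the UNCARRIED currency, NEW here] perturb the old term E^{(j)} ↦ E^{(j)} + ζδ at the larger radius
  that (B) allows (`|ζ|·‖δ‖ ≤ tε₁E₀/(θ_jg_k)`, θ_j the age share of (1.24), t a free absolute number): the
  perturbation of `Σ_Yτ(Y)V_k(Y,B)` is then bounded by `tα₄e^{−δκd_k(Y)}‖B‖_{∞,Y}` per Y (ε₁ and E₀ cancel against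
  (2.18)), which after `‖B‖_{∞,Y} ≤ ½(1 + Σ_{b⊂Y}|B(b)|²)` and (1.26)-type resummation has exactly the SHAPE of the
  right side of (2.20) with α₄ replaced by O(1)·α₄ — absorbed by re-choosing the free constant α₄ (its constraints are
  (LM)⁴α₄ ≤ 1, p. 20, α₅ small, p. 17, and ε₂ ∝ α₄⁻¹ ≤ 1, p. 19: the price is a factor O(1) in the ε₁-window ε₂ ≤ 1);
  (2.21)–(2.41) are then uniform and holomorphic on the ζ-disc, and Cauchy's estimate gives a one-step memory modulus
  `≲ c″·g_k·L^{−(k−j)}` in which ε₁ AND E₀ CANCEL (`C₃ ∝ E₀ε₁⁰`, p. 20) and `c″ = O(1)(L+2)⁴C₁α₄⁻¹α₆⁻¹M^qe^{C₂κ₁}/t`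
  depends on L, M, κ₁, α₄, α₆ only — all fixed before ε₁ and γ.  In the kernel shapes of this file: `StepMemoryFn Φ γ
  (fun g ↦ c″g) L⁻¹`. Its sup over the box ]0,γ] is `C′ = c″γ` (§3: window `(1 + c″γ)L⁻¹ < ρ`), and print's p. 18
  assumption *"(1/20)γ₂ε₁²/γ² ≥ 4κ"* says `γ ≤ (γ₂/(80κ))^{1/2}ε₁` (§4), so the γ-window is an ε₁-TYPE smallness of
  the same currency as ε₂ ≤ 1 — no NEW KIND of condition enters node U2 through the memory side in either currency;
  what differs is that in currency (D) the memory constant of step j is `c″g_j`: SMALL AT THE ULTRAVIOLET HEAD of an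
  asymptotically free run (g_j increases towards the pin g_K = g, (0.31)) and at most `c″g` everywhere on it (§9) —
  structure the box-uniform shapes over ]0,γ] cannot see.
(E) [dictionary, unprinted] entries = the families {E^{(k+1)}(X)}_X in the (1.18)/(2.41)-weighted sup norm (weight
  `e^{κd_{k+1}(X)}`; *"(1−10δ)½L = 1"* reproduces κ), read-out r = the β-recipe (1.20)–(1.22) of [I] p. 264 — as in
  `T4FlagMemory`. NOT PRINTED anywhere in [I]–[III]: any MODULUS of the one-step map (constant or coupling-weighted),
  the constants c″, c‴, the scheme itself (cell GAPS G-t4-U2-1, G-b12g8-1, G-b12g8-2); this file adds nothing to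
  print's account and asserts none of (A)–(E): they only MOTIVATE the hypothesis shape `StepMemoryFn`.

## What is typed and proved (Mathlib-elementary; 0 sorry)

(§1) `StepMemoryAdm Φ γ M′` — `T4FlagMemory.StepMemory` asked only at couplings in ]0,γ]; `StepMemoryFn Φ γ Cf ω` —
  the coupling-weighted profile `Cf g·ω^{j−m}`; `stepMemoryAdm_of_fn`: a profile bounded by `C′` on the box gives the
  constant profile `C′ω^{j−m}`.

(§2) THE CLAMP `clampStep Φ γ j g y = Φ j (cl γ g) y` (`cl γ` = the identity on ]0,γ], `γ` outside): the same flag,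
  entries and scale shifts along admissible runs (`flag_clampStep`, `entry_clampStep`, `sh_clampStep`), `StepDirect` /
  `StepShift` / `Represents` inherited, and `StepMemoryAdm Φ γ M′ → StepMemory (clampStep Φ γ) M′`
  (`stepMemory_clampStep`, `γ > 0`) — so EVERY theorem of `T4FlagMemory` §3 and `T4FlagMemoryTwoRun` §3 holds with the
  memory hypothesis asked at admissible couplings only (the relativisation in the coupling announced in the docstring
  of `T4FlagMemoryTwoRun.StepInvariant`, made kernel).

(§3) NE4 IN THE γ-CURRENCY.  `ne4_of_scheme_adm`/`ne4_of_scheme_af` (represented family) and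
  `ne4_of_split_scheme_adm`/`_fn`/`_af` (split form: β⁰-half (AF-0r) as binder, β¹-half from a scheme representing
  `S.β1`): node U2's three inputs for the FULL β with the constants of `T4FlagMemory.ne4_of_split_scheme` and `C′ :=
  cγ`, window `(1 + cγ)ω < ρ ≤ 1`; `injectedRate_of_scheme_twoRun_af`: node U2's spine OUTPUT
  `T4CauchySum.InjectedRate (2(2c₀ + cr·a·κ)(1−ρ)⁻¹) 0 ρ (fun K j ↦ disc (g K) (g (K+1)) j)` by the two-run closure of
  `T4FlagMemoryTwoRun`, whose two remaining smallness conditions — memory gap `(1 + cγ)ω < ρ < 1` and gain window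
  `cr·ℓ′γ³κ ≤ (1−ρ)/2`, `κ = (ρ−ω)(ρ−(1+cγ)ω)⁻¹` — are now BOTH conditions on γ.

(§4) CURRENCY ([analysis] on verbatim displays): `afWindow_iff` (`(1 + cγ)L⁻¹ < ρ ↔ cγL⁻¹ < ρ − L⁻¹`: smallness of γ
  at fixed L), `printedGammaWindow` (p. 18's assumption is `80κγ² ≤ γ₂ε₁²`), `afConst_le_of_printedGammaWindow` (`⇒ cγ
  ≤ c(γ₂/(80κ))^{1/2}ε₁`: the γ-window is an ε₁-type smallness).

(§5) FORWARD ENVELOPE — discrete Grönwall with STEP-DEPENDENT memory constants ([folklore]): `env D i j =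
  ∏_{n∈]i,j]}(1 + D n)`; telescoping `sum_mul_env`; row lemma `row_env_le`; `renewal_env`: `x j ≤ s j +
  Σ_{m<j}M_{j,m}x m` with `0 ≤ M_{j,m} ≤ D(m+1)ω^{j−m}` (D n any bound of the memory constants of the steps ≥ n) ⇒ `x
  j ≤ Σ_{i≤j} s i·ω^{j−i}·env D i j` — no smallness (`env_const`: D ≡ C′ recovers the profile `((1 + C′)ω)^{j−i}` of
  `T4FlagMemory.dist_entry_le` / `T4BetaMemory.renewal_geometric`); `env_le_pow_of_eventually`: `0 ≤ D ≤ D̄` always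
  and `D n ≤ ε` for `n ≥ n₀` ⇒ `env D i j ≤ (1 + D̄)^{n₀}(1 + ε)^{j−i}`; `sum_pow_mul_pow_le` (geometric convolution);
  `envelope_rate`: sources `0 ≤ s i ≤ aρ^i` and the gap `(1 + ε)ω < ρ` ⇒ the profile sums to `a(1 +
  D̄)^{n₀}ρ(ρ−(1+ε)ω)⁻¹·ρ^k`.

(§6) RUN-WISE CONSEQUENCES for the generated flag: `dist_entry_step_fn` / `sh_step_fn` (the two one-step recursions of
  `T4FlagMemory` §3 with the memory constant read at the run's CURRENT coupling), `dist_entry_le_env` / `sh_le_env`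
  (pushed through the forward envelope), and the NON-INCREASING-RUN tail corollaries `sh_le_of_af_tail` — along a
  non-increasing admissible run with `c·g n ≤ ε` for `n ≥ n₀` and sources `≤ aρ^k`: `sh Φ g k ≤ a(1 +
  cγ)^{n₀}ρ(ρ−(1+ε)ω)⁻¹ρ^k` under the gap `(1 + ε)ω < ρ` ONLY — and `dist_entry_le_of_af_tail` — two-history modulus
  `Σ_{i≤j}ℓ′(1 + cγ)^{n₀}((1 + ε)ω)^{j−i}|g_i − g′_i|` (v1 names kept; NOT the orientation of the tree's AF runs, which
  INCREASE — ORIENTATION paragraph of (ii) and §9).  RUN-WISE statements: the tree's box-uniform shapes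
  `ScaleShiftRate c θ γ β` / `HistLipschitz Λ γ β` quantify over ALL histories in ]0,γ]^{k+1}, where only §3's sup
  `cγ` is available.

(§7) WITNESS ([folklore]; non-vacuity of §3 with `c, ω > 0`): the AF-weighted linear scheme `afStep ℓ′ c ω j g y = ℓ′g
  + Σ_{m<j} c·g·ω^{j−m}·sq1(y m)` on ℝ (`sq1` a bounded 1-Lipschitz squash) has `StepMemoryFn _ γ (c·) ω`,
  `StepDirect` with `ℓ′ + cω(1−ω)⁻¹`, `StepShift` with source EXACTLY `c·g_{k+1}·ω^{k+1}·sq1(entry 0)`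
  (`afStep_shift_eq`: the unpartnered finest entry weighted by its age AND by the current coupling), and `ne4_afStep`:
  the three node-U2 inputs for the family read off it, under `(1 + cγ)ω < ρ`.

(§8) WHERE THE COUPLING WEIGHT SITS: `ActInsertionFn act γ Cf ω` (activity-level insertion with the verbatim `g_k`
  factor of (1.24); printed STRUCTURE, printed-TYPE constant) + `T4FlagMemory.ActToValue val KV` (kernel in kind:
  `T4ActivityLipschitz`, cited by name in `T4FlagMemory` §6) ⇒ `StepMemoryFn (factorStep act val) γ (KV·Cf) ω`
  (`stepMemoryFn_of_factor`) — the coupling-weighted refinement of `T4FlagMemory.stepMemory_of_factor`.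

(§9, v1.1) ORIENTATION AND THE RENORMALIZED-COUPLING CURRENCY: `le_succ_of_rgEqH_sign` / `mono_of_rgEqH_sign` /
  `box_last_of_rgEqH_sign` — a run of `RGEqH` in ]0,γ] with `β ≥ 0` on the boxes (`EventualLowerH 0 γ k₀ β`, resp.
  `BetaLowerH 0 γ β`: the SIGN only) is non-decreasing, hence lies in ]0, g K] ([I] (0.31) lower half);
  `lt_succ_of_rgEqH_lower` / `not_antitone_of_rgEqH_lower` — with `β ≥ b > 0` it is strictly increasing, so §6's
  `hmono` is empty there (the referee's witness); the box-parameter monotonicity of the shapes (`mem_box_mono`,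
  `adm_mono`, `eventualLowerH_mono`, `represents_mono`, `stepMemoryFn_mono`, `stepDirect_mono`, `stepShift_mono`);
  `injectedRate_of_scheme_twoRun_af_pinned` — §3's two-run closure on the pinned runs with `γ ↦ gIR`: memory gap
  `(1 + c·gIR)ω < ρ`, gain window `cr·ℓ′·gIR³·κ ≤ (1−ρ)/2`, asking only the sign `BetaLowerH 0 γ β` in addition;
  `injectedRate_of_split_scheme_eventual_af_pinned` — the box-uniform closure likewise (window `cr·ℓ′·((k₀+1)gIR³ +
  2gIR/b) ≤ (1−ρ)/2`); `sh_le_of_pinned` / `dist_entry_le_of_pinned` — the §6 run-wise bounds on runs in ]0, gIR]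
  with the constant domination `D ≡ c·gIR` (what the birth-indexed envelope yields on increasing runs).

Deliberately NOT here: any instance of the shapes for Bałaban's (2.13); the constants c″, c‴ as NUMBERS (unprinted
absolute O(1)'s, GAPS G-b12g8-2); the STEP-indexed envelope / ultraviolet-sparse ε-gap reading of the AF runs
(sibling lineage t4-ne4-p2, `T4TwoRunAfTail`); [III]'s large-field entries (node U4′). Imports `T4FlagMemoryTwoRun` (hence `T4FlagMemory`, `T4TwoRunMatching`, `T4BetaMemorySharp`, `T4BetaMemory`,
`T4CouplingMatching`, `FlowStep`, `B12Beta`, `T4CauchySum`) and modifies nothing; Mathlib otherwise; no `sorry`, no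
`axiom`.  Unit `b2b-balaban-t4-ne4-p1` generation 4 (journal claim T4-U2.NE4-PROVE-P1d, CLAIMS.log 2026-08-19);
v1.1 = generation 5 (claim T4-U2.NE4-PROVE-P1e): DOCFIX of the orientation (referee G-t4r3-1) + §9, no v1 statement
or proof changed; companion record `t4/T4-EST-NE4-P1.md` §10–§11.

CITATION HEADER (lean-in-tree rule 2026-08-18).  T. Bałaban, *Renormalization group approach to lattice gauge field
theories. I*, Commun. Math. Phys. **109** (1987) 249–301 [Balaban1987RG1] (B12 = [I]; journal page = PDF page + 248);
T. Bałaban, *Renormalization group approach to lattice gauge field theories. II. Cluster expansions*, Commun. Math.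
Phys. **116** (1988) 1–22 [Balaban1988RG2Cluster] ([II] = B13; journal page = PDF page); T. Bałaban, *Convergent
renormalization expansions for lattice gauge theories*, Commun. Math. Phys. **119** (1988) 243–285
[Balaban1988Convergent] (B14 = [III]).
-/

namespace Literature.MathematicalPhysics.QuantumFieldTheory.Balaban1983to89.T4FlagMemoryAF

open Literature.MathematicalPhysics.QuantumFieldTheory.Balaban1983to89
open Literature.MathematicalPhysics.QuantumFieldTheory.Balaban1983to89.FlowStep
open Literature.MathematicalPhysics.QuantumFieldTheory.Balaban1983to89.T4CouplingMatching
  (ScaleShiftRate RemainderShiftRate HistLipschitz FadingMemory EventualLowerH disc)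
open Literature.MathematicalPhysics.QuantumFieldTheory.Balaban1983to89.T4BetaMemory (DataRenewal)
open Literature.MathematicalPhysics.QuantumFieldTheory.Balaban1983to89.T4FlagMemory
open Literature.MathematicalPhysics.QuantumFieldTheory.Balaban1983to89.T4FlagMemoryTwoRun
  (injectedRate_of_scheme_twoRun injectedRate_of_split_scheme_eventual)
open Finset

/-! ## §1 Memory asked at admissible couplings only; the coupling-weighted profile -/

section Shapes

variable {X : Type*} [PseudoMetricSpace X]

/-- HYPOTHESIS SHAPE — `T4FlagMemory.StepMemory` asked only at ADMISSIBLE couplings `g ∈ ]0,γ]` (the box of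
[Balaban1987RG1] Thm 3 p. 264); NOT PRINTED, never asserted. [cite: Balaban1987RG1, Thm 3 p.264] -/
def StepMemoryAdm (Φ : ℕ → ℝ → (ℕ → X) → X) (γ : ℝ) (M' : ℕ → ℕ → ℝ) : Prop :=
  ∀ j (g : ℝ) (y y' : ℕ → X), 0 < g → g ≤ γ →
    dist (Φ j g y) (Φ j g y') ≤ ∑ m ∈ range j, M' j m * dist (y m) (y' m)

/-- HYPOTHESIS SHAPE — COUPLING-WEIGHTED FUNCTIONAL MEMORY: at an admissible coupling `g` the step-j map's modulus in
the entry born at `m < j` is `Cf g · ω^{j−m}` — the memory constant depends on the coupling AT WHICH THE STEP IS TAKEN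
(located reading of [Balaban1988RG2Cluster] p. 8 «Another possibility is to use the expression g_k|B| instead of ε₁.
It gives a better bound»: `Cf g = c·g`, header (D)).  NOT PRINTED as a statement; never asserted.
[cite: Balaban1988RG2Cluster, (1.29) p.8 and Lemma 1 (1.36) p.9] -/
def StepMemoryFn (Φ : ℕ → ℝ → (ℕ → X) → X) (γ : ℝ) (Cf : ℝ → ℝ) (ω : ℝ) : Prop :=
  ∀ j (g : ℝ) (y y' : ℕ → X), 0 < g → g ≤ γ →
    dist (Φ j g y) (Φ j g y') ≤ ∑ m ∈ range j, Cf g * ω ^ (j - m) * dist (y m) (y' m)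

/-- The total shape implies the admissible one (so everything below generalises `T4FlagMemory` §3). [folklore] -/
theorem stepMemoryAdm_of_stepMemory {Φ : ℕ → ℝ → (ℕ → X) → X} {M' : ℕ → ℕ → ℝ} (γ : ℝ)
    (h : StepMemory Φ M') : StepMemoryAdm Φ γ M' :=
  fun j g y y' _ _ => h j g y y'

/-- A coupling-weighted profile bounded by `C′` on the box gives the admissible memory shape with the CONSTANT profile
`C′ω^{j−m}` (the sup over the box: this is where the γ-currency of §3 comes from). [folklore] -/
theorem stepMemoryAdm_of_fn {Φ : ℕ → ℝ → (ℕ → X) → X} {Cf : ℝ → ℝ} {ω γ C' : ℝ} (hω : 0 ≤ ω)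
    (hCf : ∀ g, 0 < g → g ≤ γ → Cf g ≤ C') (h : StepMemoryFn Φ γ Cf ω) :
    StepMemoryAdm Φ γ (fun j m => C' * ω ^ (j - m)) := by
  intro j g y y' hg0 hgγ
  refine (h j g y y' hg0 hgγ).trans (Finset.sum_le_sum fun m _ => ?_)
  exact mul_le_mul_of_nonneg_right
    (mul_le_mul_of_nonneg_right (hCf g hg0 hgγ) (pow_nonneg hω _)) dist_nonneg

end Shapes

/-! ## §2 The clamp: a scheme agreeing with `Φ` at admissible couplings, with TOTAL memory shape -/

section Clamp

variable {X : Type*}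

/-- Clamp of a real coupling to the box ]0,γ]: the identity on the box, `γ` outside. [folklore] -/
noncomputable def cl (γ g : ℝ) : ℝ := if 0 < g ∧ g ≤ γ then g else γ

/-- On the box the clamp is the identity. [folklore] -/
theorem cl_of_mem {γ g : ℝ} (h0 : 0 < g) (hγ : g ≤ γ) : cl γ g = g := if_pos ⟨h0, hγ⟩

/-- The clamp lands in the box (`γ > 0`). [folklore] -/
theorem cl_mem {γ : ℝ} (hγ : 0 < γ) (g : ℝ) : 0 < cl γ g ∧ cl γ g ≤ γ := by
  unfold cl
  split_ifs with h
  · exact h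
  · exact ⟨hγ, le_rfl⟩

/-- The CLAMPED SCHEME: the step map evaluated at the clamped coupling ("outside the box ]0,γ] an instantiation extends
`Φ j` by its value at an admissible coupling", `T4FlagMemoryTwoRun.StepInvariant` docstring) — it generates the same
flag along every admissible run and has the total memory shape whenever `Φ` has the admissible one. [folklore] -/
noncomputable def clampStep (Φ : ℕ → ℝ → (ℕ → X) → X) (γ : ℝ) : ℕ → ℝ → (ℕ → X) → X :=
  fun j g y => Φ j (cl γ g) y

/-- Unfolding of `clampStep`. [folklore] -/
@[simp] theorem clampStep_apply (Φ : ℕ → ℝ → (ℕ → X) → X) (γ : ℝ) (j : ℕ) (g : ℝ) (y : ℕ → X) :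
    clampStep Φ γ j g y = Φ j (cl γ g) y := rfl

section FlagLevel

variable [Inhabited X]

/-- Along an admissible run the clamped scheme generates the same flag. [folklore] -/
theorem flag_clampStep (Φ : ℕ → ℝ → (ℕ → X) → X) {γ : ℝ} {g : ℕ → ℝ} (hg : Adm γ g) :
    ∀ j, flag (clampStep Φ γ) g j = flag Φ g j := by
  intro j
  induction j with
  | zero => rfl
  | succ j ih =>
      funext m
      show (if m = j then clampStep Φ γ j (g j) (flag (clampStep Φ γ) g j) else flag (clampStep Φ γ) g j m)
        = (if m = j then Φ j (g j) (flag Φ g j) else flag Φ g j m)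
      rw [ih, clampStep_apply, cl_of_mem (hg j).1 (hg j).2]

/-- … hence the same entries. [folklore] -/
theorem entry_clampStep (Φ : ℕ → ℝ → (ℕ → X) → X) {γ : ℝ} {g : ℕ → ℝ} (hg : Adm γ g) (j : ℕ) :
    entry (clampStep Φ γ) g j = entry Φ g j := by
  rw [entry_def, entry_def, flag_clampStep Φ hg j, clampStep_apply, cl_of_mem (hg j).1 (hg j).2]

/-- `Represents` passes to the clamped scheme (histories in the box extend to admissible runs). [folklore] -/
theorem represents_clampStep {Φ : ℕ → ℝ → (ℕ → X) → X} {r : X → ℝ} {γ : ℝ} {β : HBeta}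
    (h : Represents Φ r γ β) : Represents (clampStep Φ γ) r γ β := by
  intro k v hv
  rw [entry_clampStep Φ (extd_adm hv) k]
  exact h k v hv

end FlagLevel

section Metric

variable [PseudoMetricSpace X]

/-- `StepDirect` passes to the clamped scheme (it only speaks about admissible couplings). [folklore] -/
theorem stepDirect_clampStep {Φ : ℕ → ℝ → (ℕ → X) → X} {ℓ' γ : ℝ} (h : StepDirect Φ ℓ' γ) :
    StepDirect (clampStep Φ γ) ℓ' γ := by
  intro j g g' y hg0 hgγ hg0' hgγ'
  rw [clampStep_apply, clampStep_apply, cl_of_mem hg0 hgγ, cl_of_mem hg0' hgγ']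
  exact h j g g' y hg0 hgγ hg0' hgγ'

/-- The ADMISSIBLE memory shape of `Φ` is the TOTAL memory shape of the clamped scheme (`γ > 0`). [folklore] -/
theorem stepMemory_clampStep {Φ : ℕ → ℝ → (ℕ → X) → X} {γ : ℝ} {M' : ℕ → ℕ → ℝ} (hγ : 0 < γ)
    (h : StepMemoryAdm Φ γ M') : StepMemory (clampStep Φ γ) M' := by
  intro j g y y'
  rw [clampStep_apply, clampStep_apply]
  exact h j (cl γ g) y y' (cl_mem hγ g).1 (cl_mem hγ g).2

variable [Inhabited X]

/-- … and the same scale shifts. [folklore] -/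
theorem sh_clampStep (Φ : ℕ → ℝ → (ℕ → X) → X) {γ : ℝ} {g : ℕ → ℝ} (hg : Adm γ g) (k : ℕ) :
    sh (clampStep Φ γ) g k = sh Φ g k := by
  unfold sh
  rw [entry_clampStep Φ hg, entry_clampStep Φ (fun m => hg (m + 1))]

/-- `StepShift` passes to the clamped scheme (it only speaks about admissible runs). [folklore] -/
theorem stepShift_clampStep {Φ : ℕ → ℝ → (ℕ → X) → X} {γ : ℝ} {src : ℕ → ℝ} (h : StepShift Φ γ src) :
    StepShift (clampStep Φ γ) γ src := by
  intro g hg k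
  have hk := h g hg k
  rw [entry_clampStep Φ hg (k + 1), clampStep_apply, cl_of_mem (hg (k + 1)).1 (hg (k + 1)).2]
  simp only [entry_clampStep Φ hg]
  exact hk

end Metric

end Clamp

/-! ## §3 NE4 in the split form from the ADMISSIBLE / COUPLING-WEIGHTED memory: the window in the γ-currency -/

section Kernel

variable {X : Type*} [PseudoMetricSpace X] [Inhabited X]

/-- **NE4 FOR A REPRESENTED FAMILY FROM THE ADMISSIBLE MEMORY SHAPE** (`T4FlagMemory.ne4_of_scheme` with
`StepMemory` weakened to `StepMemoryAdm`, `γ > 0`; via the clamp of §2).  Bookkeeping over UNPRINTED inputs.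
[cite: Balaban1987RG1, (0.23) p.256 and (2.13) p.268] -/
theorem ne4_of_scheme_adm {Φ : ℕ → ℝ → (ℕ → X) → X} {r : X → ℝ} {β : HBeta} {M' : ℕ → ℕ → ℝ}
    {src : ℕ → ℝ} {ℓ' C' ω γ cr a ρ : ℝ} (hγ : 0 < γ) (hℓ' : 0 ≤ ℓ') (hC' : 0 ≤ C') (hω : 0 ≤ ω) (hcr : 0 ≤ cr)
    (ha : 0 ≤ a) (hsmall : (1 + C') * ω < ρ)
    (hrep : Represents Φ r γ β) (hr : ReadLipschitz r cr) (hdir : StepDirect Φ ℓ' γ)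
    (hmem : StepMemoryAdm Φ γ M') (hM' : FadingMemory C' ω M') (hsh : StepShift Φ γ src)
    (hsrc : ∀ k, src k ≤ a * ρ ^ k) :
    ScaleShiftRate (cr * (a * (ρ - ω) / (ρ - (1 + C') * ω))) ρ γ β ∧
    HistLipschitz (fun k i => cr * ℓ' * ((1 + C') * ω) ^ (k - i)) γ β ∧
    FadingMemory (cr * ℓ') ρ (fun k i => cr * ℓ' * ((1 + C') * ω) ^ (k - i)) :=
  ne4_of_scheme hℓ' hC' hω hcr ha hsmall (represents_clampStep hrep) hr (stepDirect_clampStep hdir)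
    (stepMemory_clampStep hγ hmem) hM' (stepShift_clampStep hsh) hsrc

/-- **NE4 FOR A REPRESENTED FAMILY, γ-CURRENCY** (AF-weighted memory `Cf g = c·g`, `C′ = cγ`, window
`(1 + cγ)ω < ρ`).  Bookkeeping over UNPRINTED inputs. [cite: Balaban1988RG2Cluster, (1.29) p.8 and (2.31) p.18] -/
theorem ne4_of_scheme_af {Φ : ℕ → ℝ → (ℕ → X) → X} {r : X → ℝ} {β : HBeta} {src : ℕ → ℝ}
    {ℓ' c ω γ cr a ρ : ℝ} (hγ : 0 < γ) (hℓ' : 0 ≤ ℓ') (hc : 0 ≤ c) (hω : 0 ≤ ω) (hcr : 0 ≤ cr) (ha : 0 ≤ a)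
    (hsmall : (1 + c * γ) * ω < ρ)
    (hrep : Represents Φ r γ β) (hr : ReadLipschitz r cr) (hdir : StepDirect Φ ℓ' γ)
    (hmem : StepMemoryFn Φ γ (fun g => c * g) ω) (hsh : StepShift Φ γ src) (hsrc : ∀ k, src k ≤ a * ρ ^ k) :
    ScaleShiftRate (cr * (a * (ρ - ω) / (ρ - (1 + c * γ) * ω))) ρ γ β ∧
    HistLipschitz (fun k i => cr * ℓ' * ((1 + c * γ) * ω) ^ (k - i)) γ β ∧
    FadingMemory (cr * ℓ') ρ (fun k i => cr * ℓ' * ((1 + c * γ) * ω) ^ (k - i)) :=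
  ne4_of_scheme_adm hγ hℓ' (mul_nonneg hc hγ.le) hω hcr ha hsmall hrep hr hdir
    (stepMemoryAdm_of_fn hω (fun _ _ hg => mul_le_mul_of_nonneg_left hg hc) hmem)
    (fadingMemory_profile (mul_nonneg hc hγ.le) hω) hsh hsrc

/-- **NE4 (SPLIT FORM) FROM THE ADMISSIBLE MEMORY SHAPE.**  `T4FlagMemory.ne4_of_split_scheme` with `StepMemory Φ M′`
weakened to `StepMemoryAdm Φ γ M′` (memory asked only at couplings in ]0,γ], `γ > 0`): same three outputs of node U2 for
the FULL β, same constants, same window `(1 + C′)ω < ρ ≤ 1`.  Via the clamp of §2.  Bookkeeping over UNPRINTED inputs;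
nothing of [Balaban1987RG1] is asserted. [cite: Balaban1987RG1, (2.12)-(2.14) p.268] -/
theorem ne4_of_split_scheme_adm {β : HBeta} (S : B12Beta.OneLoopSplit β) {Φ : ℕ → ℝ → (ℕ → X) → X}
    {r : X → ℝ} {M' : ℕ → ℕ → ℝ} {src : ℕ → ℝ} {ℓ' C' ω γ cr a ρ binf c₀ : ℝ}
    (hγ : 0 < γ) (hℓ' : 0 ≤ ℓ') (hC' : 0 ≤ C') (hω : 0 ≤ ω) (hcr : 0 ≤ cr) (ha : 0 ≤ a) (hc₀ : 0 ≤ c₀)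
    (hsmall : (1 + C') * ω < ρ) (hρ1 : ρ ≤ 1)
    (hconv : ∀ k, |S.β0 k - binf| ≤ c₀ * ρ ^ k)
    (hrep : Represents Φ r γ S.β1) (hr : ReadLipschitz r cr) (hdir : StepDirect Φ ℓ' γ)
    (hmem : StepMemoryAdm Φ γ M') (hM' : FadingMemory C' ω M') (hsh : StepShift Φ γ src)
    (hsrc : ∀ k, src k ≤ a * ρ ^ k) :
    ScaleShiftRate (2 * c₀ + cr * (a * (ρ - ω) / (ρ - (1 + C') * ω))) ρ γ β ∧
    HistLipschitz (fun k i => cr * ℓ' * ((1 + C') * ω) ^ (k - i)) γ β ∧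
    FadingMemory (cr * ℓ') ρ (fun k i => cr * ℓ' * ((1 + C') * ω) ^ (k - i)) :=
  ne4_of_split_scheme S hℓ' hC' hω hcr ha hc₀ hsmall hρ1 hconv (represents_clampStep hrep) hr
    (stepDirect_clampStep hdir) (stepMemory_clampStep hγ hmem) hM' (stepShift_clampStep hsh) hsrc

/-- **NE4 (SPLIT FORM) FROM A COUPLING-WEIGHTED MEMORY PROFILE BOUNDED ON THE BOX.**  `StepMemoryFn Φ γ Cf ω` with
`Cf ≤ C′` on ]0,γ] (`C′, ω ≥ 0`): node U2's three outputs with the constant profile `C′ω^{age}` — the memory constant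
that enters the window `(1 + C′)ω < ρ` is the SUP OF THE PROFILE OVER THE BOX.  Bookkeeping over UNPRINTED inputs.
[cite: Balaban1988RG2Cluster, (1.29) p.8 and (2.41) p.21] -/
theorem ne4_of_split_scheme_fn {β : HBeta} (S : B12Beta.OneLoopSplit β) {Φ : ℕ → ℝ → (ℕ → X) → X}
    {r : X → ℝ} {Cf : ℝ → ℝ} {src : ℕ → ℝ} {ℓ' C' ω γ cr a ρ binf c₀ : ℝ}
    (hγ : 0 < γ) (hℓ' : 0 ≤ ℓ') (hC' : 0 ≤ C') (hω : 0 ≤ ω) (hcr : 0 ≤ cr) (ha : 0 ≤ a) (hc₀ : 0 ≤ c₀)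
    (hsmall : (1 + C') * ω < ρ) (hρ1 : ρ ≤ 1)
    (hconv : ∀ k, |S.β0 k - binf| ≤ c₀ * ρ ^ k)
    (hrep : Represents Φ r γ S.β1) (hr : ReadLipschitz r cr) (hdir : StepDirect Φ ℓ' γ)
    (hCf : ∀ g, 0 < g → g ≤ γ → Cf g ≤ C') (hmem : StepMemoryFn Φ γ Cf ω) (hsh : StepShift Φ γ src)
    (hsrc : ∀ k, src k ≤ a * ρ ^ k) :
    ScaleShiftRate (2 * c₀ + cr * (a * (ρ - ω) / (ρ - (1 + C') * ω))) ρ γ β ∧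
    HistLipschitz (fun k i => cr * ℓ' * ((1 + C') * ω) ^ (k - i)) γ β ∧
    FadingMemory (cr * ℓ') ρ (fun k i => cr * ℓ' * ((1 + C') * ω) ^ (k - i)) :=
  ne4_of_split_scheme_adm S hγ hℓ' hC' hω hcr ha hc₀ hsmall hρ1 hconv hrep hr hdir
    (stepMemoryAdm_of_fn hω hCf hmem) (fadingMemory_profile hC' hω) hsh hsrc

/-- **NE4 (SPLIT FORM) IN THE γ-CURRENCY — the AF-weighted memory `Cf g = c·g`.**  If the one-step memory constant is
proportional to the coupling at which the step is taken (located reading (D) of the header: the UNCARRIED variant of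
[Balaban1988RG2Cluster] p. 8, ε₁ cancels), then node U2's three outputs for the FULL β hold with `C′ = cγ` and the
window reads `(1 + cγ)ω < ρ ≤ 1` — a smallness of γ (print's own «γ² sufficiently small, depending on M and κ», p. 18,
is of this type).  HYPOTHESES ONLY; `c` is an UNPRINTED absolute constant; NOT summit progress.
[cite: Balaban1988RG2Cluster, (1.29) p.8 and (2.31) p.18] -/
theorem ne4_of_split_scheme_af {β : HBeta} (S : B12Beta.OneLoopSplit β) {Φ : ℕ → ℝ → (ℕ → X) → X}
    {r : X → ℝ} {src : ℕ → ℝ} {ℓ' c ω γ cr a ρ binf c₀ : ℝ}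
    (hγ : 0 < γ) (hℓ' : 0 ≤ ℓ') (hc : 0 ≤ c) (hω : 0 ≤ ω) (hcr : 0 ≤ cr) (ha : 0 ≤ a) (hc₀ : 0 ≤ c₀)
    (hsmall : (1 + c * γ) * ω < ρ) (hρ1 : ρ ≤ 1)
    (hconv : ∀ k, |S.β0 k - binf| ≤ c₀ * ρ ^ k)
    (hrep : Represents Φ r γ S.β1) (hr : ReadLipschitz r cr) (hdir : StepDirect Φ ℓ' γ)
    (hmem : StepMemoryFn Φ γ (fun g => c * g) ω) (hsh : StepShift Φ γ src)
    (hsrc : ∀ k, src k ≤ a * ρ ^ k) :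
    ScaleShiftRate (2 * c₀ + cr * (a * (ρ - ω) / (ρ - (1 + c * γ) * ω))) ρ γ β ∧
    HistLipschitz (fun k i => cr * ℓ' * ((1 + c * γ) * ω) ^ (k - i)) γ β ∧
    FadingMemory (cr * ℓ') ρ (fun k i => cr * ℓ' * ((1 + c * γ) * ω) ^ (k - i)) :=
  ne4_of_split_scheme_fn S hγ hℓ' (mul_nonneg hc hγ.le) hω hcr ha hc₀ hsmall hρ1 hconv hrep hr hdir
    (fun _ _ hg => mul_le_mul_of_nonneg_left hg hc) hmem hsh hsrc

/-- **NODE U2's SPINE OUTPUT BY THE TWO-RUN CLOSURE, γ-CURRENCY.**  `T4FlagMemoryTwoRun.injectedRate_of_scheme_twoRun`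
with the AF-weighted memory `StepMemoryFn Φ γ (c·) ω` in place of `StepMemory`/`FadingMemory`: K-uniform
`T4CauchySum.InjectedRate (2(2c₀ + cr·a·κ)(1−ρ)⁻¹) 0 ρ (fun K j ↦ disc (g K) (g (K+1)) j)`,
`κ = (ρ−ω)(ρ−(1+cγ)ω)⁻¹`, under the memory gap `(1 + cγ)ω < ρ < 1`, (AF-0r) and the window
`cr·ℓ′γ³κ ≤ (1−ρ)/2` — BOTH remaining smallness conditions are now conditions on γ.  Bookkeeping over UNPRINTED inputs;
NOT summit progress. [cite: Balaban1987RG1, (0.20) p.256 and Thm 2 p.259] -/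
theorem injectedRate_of_scheme_twoRun_af {β : HBeta} (S : B12Beta.OneLoopSplit β) {Φ : ℕ → ℝ → (ℕ → X) → X}
    {r : X → ℝ} {src : ℕ → ℝ} {ℓ' c ω γ cr a ρ binf c₀ : ℝ} (g : ℕ → ℕ → ℝ) (gIR : ℝ)
    (hγ : 0 < γ) (hρ1 : ρ < 1) (hω : 0 ≤ ω) (hc : 0 ≤ c) (hsmall : (1 + c * γ) * ω < ρ)
    (hc₀ : 0 ≤ c₀) (ha : 0 ≤ a) (hℓ' : 0 ≤ ℓ') (hcr : 0 ≤ cr)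
    (hrep : Represents Φ r γ S.β1) (hr : ReadLipschitz r cr) (hdir : StepDirect Φ ℓ' γ)
    (hmem : StepMemoryFn Φ γ (fun g => c * g) ω) (hsh : StepShift Φ γ src)
    (hsrc : ∀ k, src k ≤ a * ρ ^ k)
    (hrun : ∀ K, RGEqH K β (g K)) (hbox : ∀ K i, i ≤ K → 0 < g K i ∧ g K i ≤ γ) (hpin : ∀ K, g K K = gIR)
    (hconv : ∀ k, |S.β0 k - binf| ≤ c₀ * ρ ^ k)
    (hgain : cr * (ℓ' * γ ^ 3) * ((ρ - ω) / (ρ - (1 + c * γ) * ω)) ≤ (1 - ρ) / 2) :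
    T4CauchySum.InjectedRate (2 * (2 * c₀ + cr * a * ((ρ - ω) / (ρ - (1 + c * γ) * ω))) / (1 - ρ)) 0 ρ
      (fun K j => disc (g K) (g (K + 1)) j) :=
  injectedRate_of_scheme_twoRun S g gIR hρ1 hω (mul_nonneg hc hγ.le) hsmall hc₀ ha hℓ' hcr
    (represents_clampStep hrep) hr (stepDirect_clampStep hdir)
    (stepMemory_clampStep hγ (stepMemoryAdm_of_fn hω (fun _ _ hg => mul_le_mul_of_nonneg_left hg hc) hmem))
    (fadingMemory_profile (mul_nonneg hc hγ.le) hω) (stepShift_clampStep hsh) hsrc hrun hbox hpin hconv hgain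

end Kernel

/-! ## §4 The γ-window in print's currency (located; [analysis] on the displays of [II] quoted in the header) -/

/-- With the activity-level age weight `ω = L⁻¹` and the AF-weighted constant `C′ = cγ`, the memory gap
`(1 + cγ)L⁻¹ < ρ` reads `cγL⁻¹ < ρ − L⁻¹`: a SMALLNESS OF γ at fixed L, ρ (never "L large": L is a fixed integer chosen
before ε₁ and γ, [Balaban1988RG2Cluster] p. 21 «(1−10δ)½L = 1»). [analysis] [cite: Balaban1988RG2Cluster, (2.41) p.21] -/
theorem afWindow_iff {L c γ ρ : ℝ} : (1 + c * γ) * L⁻¹ < ρ ↔ c * γ * L⁻¹ < ρ - L⁻¹ := by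
  rw [add_mul, one_mul]
  constructor <;> intro h <;> linarith

/-- PRINT'S OWN γ-VERSUS-ε₁ ASSUMPTION ([Balaban1988RG2Cluster] p. 18, verbatim «Assuming (1/20)γ₂ε₁²/g_k² ≥
(1/20)γ₂ε₁²/γ² ≥ 4κ»): it says `80κγ² ≤ γ₂ε₁²`. [cite: Balaban1988RG2Cluster, (2.31) p.18] -/
theorem printedGammaWindow {γ γ₂ ε₁ κ : ℝ} (hγ : 0 < γ) (h : 4 * κ ≤ 1 / 20 * γ₂ * ε₁ ^ 2 / γ ^ 2) :
    80 * κ * γ ^ 2 ≤ γ₂ * ε₁ ^ 2 := by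
  have hγ2 : 0 < γ ^ 2 := by positivity
  rw [le_div_iff₀ hγ2] at h
  linarith

/-- … hence `γ ≤ (γ₂/(80κ))^{1/2}·ε₁` (`κ > 0`): under print's assumption the AF-weighted memory constant `C′ = cγ` is
`≤ c(γ₂/(80κ))^{1/2}·ε₁` — the γ-window of `ne4_of_split_scheme_af` is an ε₁-TYPE smallness, of the same currency as
[II] p. 19 «We have used the assumption ε₂ ≤ 1» (γ₂, κ are fixed before ε₁).  [analysis] on a verbatim display; the
constant `c` is UNPRINTED. [cite: Balaban1988RG2Cluster, (2.31) p.18 and (2.33) p.19] -/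
theorem afConst_le_of_printedGammaWindow {c γ γ₂ ε₁ κ : ℝ} (hc : 0 ≤ c) (hκ : 0 < κ) (hγ : 0 ≤ γ) (hε₁ : 0 ≤ ε₁)
    (h : 80 * κ * γ ^ 2 ≤ γ₂ * ε₁ ^ 2) : c * γ ≤ c * (Real.sqrt (γ₂ / (80 * κ)) * ε₁) := by
  refine mul_le_mul_of_nonneg_left ?_ hc
  have h80 : 0 < 80 * κ := by positivity
  have h1 : γ ^ 2 ≤ γ₂ / (80 * κ) * ε₁ ^ 2 := by
    rw [div_mul_eq_mul_div, le_div_iff₀ h80]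
    linarith
  calc γ = Real.sqrt (γ ^ 2) := (Real.sqrt_sq hγ).symm
    _ ≤ Real.sqrt (γ₂ / (80 * κ) * ε₁ ^ 2) := Real.sqrt_le_sqrt h1
    _ = Real.sqrt (γ₂ / (80 * κ)) * ε₁ := by
        rw [Real.sqrt_mul' _ (sq_nonneg ε₁), Real.sqrt_sq hε₁]

/-! ## §5 Forward envelope: step-dependent memory constants dominated from the birth index on (eventual fading
with NO window along runs whose memory constants are eventually small from some step on — see §6/§9 for which runs) -/

section Envelope

/-- The FORWARD ENVELOPE of a sequence of step constants `D`: `env D i j = ∏_{n∈]i,j]} (1 + D n)` — the factor by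
which an influence born at step `i` can be amplified by the memory of the steps `i+1, …, j`.  For constant `D ≡ C′`
it is `(1 + C′)^{j−i}` (the profile of `T4FlagMemory.dist_entry_le`). [folklore] -/
def env (D : ℕ → ℝ) (i j : ℕ) : ℝ := ∏ n ∈ Ico (i + 1) (j + 1), (1 + D n)

/-- No amplification at age 0. [folklore] -/
@[simp] theorem env_self (D : ℕ → ℝ) (i : ℕ) : env D i i = 1 := by simp [env]

/-- One more step multiplies the envelope by `1 + D (j+1)`. [folklore] -/
theorem env_succ (D : ℕ → ℝ) {i j : ℕ} (hij : i ≤ j) : env D i (j + 1) = env D i j * (1 + D (j + 1)) := by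
  unfold env
  rw [Finset.prod_Ico_succ_top (by omega : i + 1 ≤ j + 1)]

/-- The envelope of non-negative constants is `≥ 1`. [folklore] -/
theorem one_le_env {D : ℕ → ℝ} (hD : ∀ n, 0 ≤ D n) (i j : ℕ) : 1 ≤ env D i j := by
  unfold env
  calc (1 : ℝ) = ∏ _n ∈ Ico (i + 1) (j + 1), (1 : ℝ) := by simp
    _ ≤ ∏ n ∈ Ico (i + 1) (j + 1), (1 + D n) :=
        Finset.prod_le_prod (fun _ _ => zero_le_one) fun n _ => by linarith [hD n]

/-- … in particular non-negative. [folklore] -/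
theorem env_nonneg {D : ℕ → ℝ} (hD : ∀ n, 0 ≤ D n) (i j : ℕ) : 0 ≤ env D i j :=
  zero_le_one.trans (one_le_env hD i j)

/-- Constant step constants: the envelope is the geometric profile `(1 + C′)^{j−i}`. [folklore] -/
theorem env_const (C' : ℝ) {i j : ℕ} (hij : i ≤ j) : env (fun _ => C') i j = (1 + C') ^ (j - i) := by
  unfold env
  rw [Finset.prod_const, Nat.card_Ico]
  congr 1
  omega

/-- TELESCOPING (the discrete `d/dt e^{∫D} = D e^{∫D}`): `Σ_{m∈[i,j)} D(m+1)·env D i m = env D i j − 1`. [folklore] -/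
theorem sum_mul_env (D : ℕ → ℝ) {i j : ℕ} (hij : i ≤ j) :
    ∑ m ∈ Ico i j, D (m + 1) * env D i m = env D i j - 1 := by
  induction j, hij using Nat.le_induction with
  | base => simp
  | succ j hij ih => rw [Finset.sum_Ico_succ_top hij, ih, env_succ D hij]; ring

/-- ROW LEMMA: the profile `ω^{j−i}·env D i j` is a supersolution of the renewal with memory `≤ D(m+1)ω^{j−m}`:
`Σ_{m∈[i,j)} D(m+1)ω^{j−m}·(ω^{m−i} env D i m) ≤ ω^{j−i} env D i j` (indeed `= ω^{j−i}(env D i j − 1)`).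
The step-dependent form of `T4FlagMemory.row_le`. [folklore] -/
theorem row_env_le {D : ℕ → ℝ} {ω : ℝ} (hω : 0 ≤ ω) (hD : ∀ n, 0 ≤ D n) {i j : ℕ} (hij : i ≤ j) :
    ∑ m ∈ Ico i j, D (m + 1) * ω ^ (j - m) * (ω ^ (m - i) * env D i m) ≤ ω ^ (j - i) * env D i j := by
  have hre : ∑ m ∈ Ico i j, D (m + 1) * ω ^ (j - m) * (ω ^ (m - i) * env D i m)
      = ω ^ (j - i) * ∑ m ∈ Ico i j, D (m + 1) * env D i m := by
    rw [Finset.mul_sum]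
    refine Finset.sum_congr rfl fun m hm => ?_
    have hm' := Finset.mem_Ico.mp hm
    have hpow : ω ^ (j - m) * ω ^ (m - i) = ω ^ (j - i) := by
      rw [← pow_add]; congr 1; omega
    calc D (m + 1) * ω ^ (j - m) * (ω ^ (m - i) * env D i m)
        = (ω ^ (j - m) * ω ^ (m - i)) * (D (m + 1) * env D i m) := by ring
      _ = ω ^ (j - i) * (D (m + 1) * env D i m) := by rw [hpow]
  rw [hre, sum_mul_env D hij]
  have := one_le_env hD i j
  exact mul_le_mul_of_nonneg_left (by linarith) (pow_nonneg hω _)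

/-- **DISCRETE GRÖNWALL WITH A FORWARD ENVELOPE (abstract).**  A non-negative-sourced renewal
`x j ≤ s j + Σ_{m<j} M_{j,m} x m` whose memory of the entry born at `m` is at most `D(m+1)·ω^{j−m}` — `D n` any bound of
the memory constants of the steps `≥ n`, e.g. `D n = sup_{j ≥ n} C_j` — is dominated by
`x j ≤ Σ_{i≤j} s i · ω^{j−i} · ∏_{n∈]i,j]}(1 + D n)`.  With `D ≡ C′` this is `T4BetaMemory`'s geometric profile
`((1+C′)ω)^{j−i}`; with `D n → 0` (memory constants eventually small from some step on — for `C_j = c·g_j` this is a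
NON-INCREASING run, NOT the tree's increasing AF runs, §9) the amplification factor is eventually as close to 1 per
step as desired (`env_le_pow_of_eventually`).  Strong induction; no smallness. [folklore] -/
theorem renewal_env {x s : ℕ → ℝ} {M : ℕ → ℕ → ℝ} {D : ℕ → ℝ} {ω : ℝ} (hω : 0 ≤ ω)
    (hD : ∀ n, 0 ≤ D n) (hs : ∀ j, 0 ≤ s j)
    (hM : ∀ j m, m < j → 0 ≤ M j m ∧ M j m ≤ D (m + 1) * ω ^ (j - m))
    (hrec : ∀ j, x j ≤ s j + ∑ m ∈ range j, M j m * x m) :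
    ∀ j, x j ≤ ∑ i ∈ range (j + 1), s i * (ω ^ (j - i) * env D i j) := by
  intro j
  induction j using Nat.strong_induction_on with
  | _ j ih =>
    have hP : ∀ i m, 0 ≤ ω ^ (m - i) * env D i m := fun i m => mul_nonneg (pow_nonneg hω _) (env_nonneg hD i m)
    -- the induction hypothesis inside the memory sum, then the envelope bound on the memory
    have h2 : ∑ m ∈ range j, M j m * x m
        ≤ ∑ m ∈ range j, D (m + 1) * ω ^ (j - m) * ∑ i ∈ range (m + 1), s i * (ω ^ (m - i) * env D i m) := by
      refine Finset.sum_le_sum fun m hm => ?_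
      have hmj : m < j := mem_range.mp hm
      calc M j m * x m ≤ M j m * ∑ i ∈ range (m + 1), s i * (ω ^ (m - i) * env D i m) :=
            mul_le_mul_of_nonneg_left (ih m hmj) (hM j m hmj).1
        _ ≤ D (m + 1) * ω ^ (j - m) * ∑ i ∈ range (m + 1), s i * (ω ^ (m - i) * env D i m) :=
            mul_le_mul_of_nonneg_right (hM j m hmj).2
              (Finset.sum_nonneg fun i _ => mul_nonneg (hs i) (hP i m))
    -- interchange of the two summations (i ≤ m < j)
    have h3 : ∑ m ∈ range j, D (m + 1) * ω ^ (j - m) * ∑ i ∈ range (m + 1), s i * (ω ^ (m - i) * env D i m)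
        = ∑ i ∈ range j, s i * ∑ m ∈ Ico i j, D (m + 1) * ω ^ (j - m) * (ω ^ (m - i) * env D i m) := by
      simp only [Finset.range_eq_Ico]
      calc ∑ m ∈ Ico 0 j, D (m + 1) * ω ^ (j - m) * ∑ i ∈ Ico 0 (m + 1), s i * (ω ^ (m - i) * env D i m)
          = ∑ m ∈ Ico 0 j, ∑ i ∈ Ico 0 (m + 1),
              D (m + 1) * ω ^ (j - m) * (s i * (ω ^ (m - i) * env D i m)) :=
            Finset.sum_congr rfl fun m _ => Finset.mul_sum _ _ _
        _ = ∑ i ∈ Ico 0 j, ∑ m ∈ Ico i j, D (m + 1) * ω ^ (j - m) * (s i * (ω ^ (m - i) * env D i m)) :=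
            (Finset.sum_Ico_Ico_comm 0 j _).symm
        _ = ∑ i ∈ Ico 0 j, s i * ∑ m ∈ Ico i j, D (m + 1) * ω ^ (j - m) * (ω ^ (m - i) * env D i m) := by
            refine Finset.sum_congr rfl fun i _ => ?_
            rw [Finset.mul_sum]
            exact Finset.sum_congr rfl fun m _ => by ring
    -- each row is dominated by the profile
    have h4 : ∀ i ∈ range j, s i * ∑ m ∈ Ico i j, D (m + 1) * ω ^ (j - m) * (ω ^ (m - i) * env D i m)
        ≤ s i * (ω ^ (j - i) * env D i j) := fun i hi =>
      mul_le_mul_of_nonneg_left (row_env_le hω hD (mem_range.mp hi).le) (hs i)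
    calc x j ≤ s j + ∑ m ∈ range j, M j m * x m := hrec j
      _ ≤ s j + ∑ i ∈ range j, s i * ∑ m ∈ Ico i j, D (m + 1) * ω ^ (j - m) * (ω ^ (m - i) * env D i m) := by
          rw [← h3]; exact add_le_add le_rfl h2
      _ ≤ s j + ∑ i ∈ range j, s i * (ω ^ (j - i) * env D i j) := add_le_add le_rfl (Finset.sum_le_sum h4)
      _ = ∑ i ∈ range (j + 1), s i * (ω ^ (j - i) * env D i j) := by
          rw [Finset.sum_range_succ, Nat.sub_self, pow_zero, env_self, one_mul, mul_one, add_comm]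

/-- EVENTUALLY SMALL STEP CONSTANTS: if `0 ≤ D n ≤ D̄` always and `D n ≤ ε` for `n ≥ n₀` (`ε ≥ 0`), then
`env D i j ≤ (1 + D̄)^{n₀}·(1 + ε)^{j−i}` (`i ≤ j`) — the first `n₀` steps cost a CONSTANT, after that the per-step
amplification is `1 + ε`. [folklore] -/
theorem env_le_pow_of_eventually {D : ℕ → ℝ} {Dbar ε : ℝ} {n₀ : ℕ} (hD : ∀ n, 0 ≤ D n) (hDbar : ∀ n, D n ≤ Dbar)
    (hε : 0 ≤ ε) (hev : ∀ n, n₀ ≤ n → D n ≤ ε) {i j : ℕ} (hij : i ≤ j) :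
    env D i j ≤ (1 + Dbar) ^ n₀ * (1 + ε) ^ (j - i) := by
  have hDbar0 : 0 ≤ Dbar := (hD 0).trans (hDbar 0)
  unfold env
  rw [← Finset.prod_filter_mul_prod_filter_not (Ico (i + 1) (j + 1)) (fun n => n < n₀)]
  refine mul_le_mul ?_ ?_ (Finset.prod_nonneg fun n _ => by linarith [hD n]) (pow_nonneg (by linarith) _)
  · calc ∏ n ∈ (Ico (i + 1) (j + 1)).filter (fun n => n < n₀), (1 + D n)
        ≤ ∏ n ∈ (Ico (i + 1) (j + 1)).filter (fun n => n < n₀), (1 + Dbar) :=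
          Finset.prod_le_prod (fun n _ => by linarith [hD n]) fun n _ => by linarith [hDbar n]
      _ = (1 + Dbar) ^ ((Ico (i + 1) (j + 1)).filter (fun n => n < n₀)).card := Finset.prod_const _
      _ ≤ (1 + Dbar) ^ n₀ := by
          refine pow_le_pow_right₀ (by linarith) ?_
          calc ((Ico (i + 1) (j + 1)).filter (fun n => n < n₀)).card ≤ (range n₀).card :=
                Finset.card_le_card fun n hn => by
                  simp only [Finset.mem_filter, Finset.mem_Ico, Finset.mem_range] at hn ⊢
                  exact hn.2
            _ = n₀ := Finset.card_range n₀
  · calc ∏ n ∈ (Ico (i + 1) (j + 1)).filter (fun n => ¬ n < n₀), (1 + D n)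
        ≤ ∏ n ∈ (Ico (i + 1) (j + 1)).filter (fun n => ¬ n < n₀), (1 + ε) :=
          Finset.prod_le_prod (fun n _ => by linarith [hD n]) fun n hn => by
            have hn' := (Finset.mem_filter.mp hn).2
            linarith [hev n (by omega)]
      _ = (1 + ε) ^ ((Ico (i + 1) (j + 1)).filter (fun n => ¬ n < n₀)).card := Finset.prod_const _
      _ ≤ (1 + ε) ^ (j - i) := by
          refine pow_le_pow_right₀ (by linarith) ?_
          calc ((Ico (i + 1) (j + 1)).filter (fun n => ¬ n < n₀)).card ≤ (Ico (i + 1) (j + 1)).card :=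
                Finset.card_filter_le _ _
            _ = j - i := by rw [Nat.card_Ico]; omega

/-- GEOMETRIC CONVOLUTION: `Σ_{i≤k} ρ^i ν^{k−i} ≤ ρ(ρ−ν)⁻¹·ρ^k` for `0 ≤ ν < ρ`. [folklore] -/
theorem sum_pow_mul_pow_le {ν ρ : ℝ} (hν : 0 ≤ ν) (hνρ : ν < ρ) :
    ∀ k, ∑ i ∈ range (k + 1), ρ ^ i * ν ^ (k - i) ≤ ρ / (ρ - ν) * ρ ^ k := by
  have hρ : 0 < ρ := lt_of_le_of_lt hν hνρ
  have hd : 0 < ρ - ν := sub_pos.mpr hνρ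
  intro k
  induction k with
  | zero =>
      simp only [zero_add, Finset.sum_range_one, Nat.sub_self, pow_zero, mul_one]
      rw [le_div_iff₀ hd]
      linarith
  | succ k ih =>
      have hsplit : ∑ i ∈ range (k + 2), ρ ^ i * ν ^ (k + 1 - i)
          = ν * ∑ i ∈ range (k + 1), ρ ^ i * ν ^ (k - i) + ρ ^ (k + 1) := by
        rw [Finset.sum_range_succ, Nat.sub_self, pow_zero, mul_one, Finset.mul_sum]
        congr 1
        refine Finset.sum_congr rfl fun i hi => ?_
        have hik : i ≤ k := Nat.lt_succ_iff.mp (mem_range.mp hi)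
        rw [show k + 1 - i = (k - i) + 1 by omega, pow_succ]
        ring
      rw [hsplit]
      have hk : ν * ∑ i ∈ range (k + 1), ρ ^ i * ν ^ (k - i) ≤ ν * (ρ / (ρ - ν) * ρ ^ k) :=
        mul_le_mul_of_nonneg_left ih hν
      have key : ν * (ρ / (ρ - ν) * ρ ^ k) + ρ ^ (k + 1) = ρ / (ρ - ν) * ρ ^ (k + 1) := by
        field_simp
        ring
      linarith [key]

/-- **EVENTUAL PROFILE ⇒ GEOMETRIC RATE WITH THE GAP `(1 + ε)ω < ρ` ONLY.**  Geometric sources `s i ≤ aρ^i` pushed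
through the forward envelope of eventually-ε step constants: `Σ_{i≤k} s i·ω^{k−i} env D i k ≤ a(1+D̄)^{n₀}ρ(ρ−(1+ε)ω)⁻¹·ρ^k`.
So in the renewal of `renewal_env` the memory gap needed for the rate ρ is `(1 + ε)ω < ρ` for ANY ε eventually
dominating the step constants from `n₀` on — there the window `(1 + C′)ω < ρ` of `T4BetaMemory.renewal_geometric`
degenerates to `(1 + ε)ω < ρ` at the price of the constant `(1 + D̄)^{n₀}` (abstract; on the generated flag this asks a
NON-INCREASING run, §6 — not the orientation of the tree's AF runs, §9). [folklore] -/
theorem envelope_rate {s : ℕ → ℝ} {D : ℕ → ℝ} {Dbar ε ω ρ a : ℝ} {n₀ : ℕ} (hω : 0 ≤ ω) (ha : 0 ≤ a)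
    (hD : ∀ n, 0 ≤ D n) (hDbar : ∀ n, D n ≤ Dbar) (hε : 0 ≤ ε) (hev : ∀ n, n₀ ≤ n → D n ≤ ε)
    (hgap : (1 + ε) * ω < ρ) (hs0 : ∀ i, 0 ≤ s i) (hs : ∀ i, s i ≤ a * ρ ^ i) (k : ℕ) :
    ∑ i ∈ range (k + 1), s i * (ω ^ (k - i) * env D i k)
      ≤ a * (1 + Dbar) ^ n₀ * (ρ / (ρ - (1 + ε) * ω)) * ρ ^ k := by
  have hDbar0 : 0 ≤ Dbar := (hD 0).trans (hDbar 0)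
  have hν : 0 ≤ (1 + ε) * ω := mul_nonneg (by linarith) hω
  have hK : 0 ≤ a * (1 + Dbar) ^ n₀ := mul_nonneg ha (pow_nonneg (by linarith) _)
  calc ∑ i ∈ range (k + 1), s i * (ω ^ (k - i) * env D i k)
      ≤ ∑ i ∈ range (k + 1), a * ρ ^ i * (ω ^ (k - i) * ((1 + Dbar) ^ n₀ * (1 + ε) ^ (k - i))) := by
        refine Finset.sum_le_sum fun i hi => ?_
        have hik : i ≤ k := Nat.lt_succ_iff.mp (mem_range.mp hi)
        exact mul_le_mul (hs i) (mul_le_mul_of_nonneg_left (env_le_pow_of_eventually hD hDbar hε hev hik)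
          (pow_nonneg hω _)) (mul_nonneg (pow_nonneg hω _) (env_nonneg hD i k))
          ((hs0 i).trans (hs i))
    _ = a * (1 + Dbar) ^ n₀ * ∑ i ∈ range (k + 1), ρ ^ i * ((1 + ε) * ω) ^ (k - i) := by
        rw [Finset.mul_sum]
        refine Finset.sum_congr rfl fun i _ => ?_
        rw [mul_pow]
        ring
    _ ≤ a * (1 + Dbar) ^ n₀ * (ρ / (ρ - (1 + ε) * ω) * ρ ^ k) :=
        mul_le_mul_of_nonneg_left (sum_pow_mul_pow_le hν hgap k) hK
    _ = a * (1 + Dbar) ^ n₀ * (ρ / (ρ - (1 + ε) * ω)) * ρ ^ k := by ring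

end Envelope

/-! ## §6 The forward envelope on the generated flag: run-wise two-history modulus and scale shift under the
coupling-weighted memory; the NON-INCREASING-RUN tail (v1.1: NOT the orientation of the tree's AF runs — §9) -/

section RunWise

variable {X : Type*} [PseudoMetricSpace X] [Inhabited X]

/-- ONE STEP OF THE TWO-HISTORY RECURSION under the coupling-weighted memory: along admissible runs `g, g′`,
`a_j ≤ ℓ′|g_j − g′_j| + Σ_{m<j} Cf(g′_j)ω^{j−m} a_m`, `a_m = dist (entry Φ g m) (entry Φ g′ m)` — the memory constant
is read at run g′'s coupling of the CURRENT step. [folklore] -/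
theorem dist_entry_step_fn {Φ : ℕ → ℝ → (ℕ → X) → X} {Cf : ℝ → ℝ} {ℓ' ω γ : ℝ} {g g' : ℕ → ℝ}
    (hdir : StepDirect Φ ℓ' γ) (hmem : StepMemoryFn Φ γ Cf ω) (hg : Adm γ g) (hg' : Adm γ g') (j : ℕ) :
    dist (entry Φ g j) (entry Φ g' j)
      ≤ ℓ' * |g j - g' j| + ∑ m ∈ range j, Cf (g' j) * ω ^ (j - m) * dist (entry Φ g m) (entry Φ g' m) := by
  have hA := hdir j (g j) (g' j) (flag Φ g j) (hg j).1 (hg j).2 (hg' j).1 (hg' j).2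
  have hB := hmem j (g' j) (flag Φ g j) (flag Φ g' j) (hg' j).1 (hg' j).2
  have hB' : ∑ m ∈ range j, Cf (g' j) * ω ^ (j - m) * dist (flag Φ g j m) (flag Φ g' j m)
      = ∑ m ∈ range j, Cf (g' j) * ω ^ (j - m) * dist (entry Φ g m) (entry Φ g' m) := by
    refine Finset.sum_congr rfl fun m hm => ?_
    have hmj : m < j := mem_range.mp hm
    rw [flag_apply, flag_apply, if_pos hmj, if_pos hmj]
  rw [entry_def, entry_def]
  calc dist (Φ j (g j) (flag Φ g j)) (Φ j (g' j) (flag Φ g' j))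
      ≤ dist (Φ j (g j) (flag Φ g j)) (Φ j (g' j) (flag Φ g j))
        + dist (Φ j (g' j) (flag Φ g j)) (Φ j (g' j) (flag Φ g' j)) := dist_triangle _ _ _
    _ ≤ ℓ' * |g j - g' j| + ∑ m ∈ range j, Cf (g' j) * ω ^ (j - m) * dist (entry Φ g m) (entry Φ g' m) := by
        rw [← hB']
        exact add_le_add hA hB

/-- **RUN-WISE TWO-HISTORY MODULUS WITH THE FORWARD ENVELOPE.**  Under `StepDirect Φ ℓ′ γ` and the coupling-weighted
memory `StepMemoryFn Φ γ Cf ω` (`Cf ≥ 0` on the box, `ω ≥ 0`), along admissible runs `g, g′` whose memory constants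
from step `n` on are dominated by `D n ≥ 0` (`Cf (g′ j) ≤ D n` for `n ≤ j`; for `Cf` monotone and run g′ NON-INCREASING
`D n = Cf (g′ n)`; for a run bounded by `gIR` — e.g. the tree's increasing pinned runs, §9 — `D ≡ Cf gIR`):
`dist (entry Φ g j) (entry Φ g′ j) ≤ Σ_{i≤j} ℓ′|g_i − g′_i|·ω^{j−i}·∏_{n∈]i,j]}(1 + D n)`.
`T4FlagMemory.dist_entry_le` is the case `D ≡ C′`.  No smallness. [folklore] -/
theorem dist_entry_le_env {Φ : ℕ → ℝ → (ℕ → X) → X} {Cf : ℝ → ℝ} {D : ℕ → ℝ} {ℓ' ω γ : ℝ} {g g' : ℕ → ℝ}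
    (hℓ' : 0 ≤ ℓ') (hω : 0 ≤ ω) (hCf : ∀ x, 0 < x → x ≤ γ → 0 ≤ Cf x) (hD : ∀ n, 0 ≤ D n)
    (hdir : StepDirect Φ ℓ' γ) (hmem : StepMemoryFn Φ γ Cf ω) (hg : Adm γ g) (hg' : Adm γ g')
    (hdom : ∀ n j, n ≤ j → Cf (g' j) ≤ D n) :
    ∀ j, dist (entry Φ g j) (entry Φ g' j)
      ≤ ∑ i ∈ range (j + 1), ℓ' * |g i - g' i| * (ω ^ (j - i) * env D i j) :=
  renewal_env (M := fun j m => Cf (g' j) * ω ^ (j - m)) hω hD (fun i => mul_nonneg hℓ' (abs_nonneg _))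
    (fun j m hmj => ⟨mul_nonneg (hCf _ (hg' j).1 (hg' j).2) (pow_nonneg hω _),
      mul_le_mul_of_nonneg_right (hdom (m + 1) j (by omega)) (pow_nonneg hω _)⟩)
    (dist_entry_step_fn hdir hmem hg hg')

/-- ONE STEP OF THE SCALE-SHIFT RENEWAL under the coupling-weighted memory: along an admissible run-B sequence `g`,
`sh Φ g k ≤ src k + Σ_{m<k} Cf(g (k+1))ω^{k−m} sh Φ g m` — the step-k map is applied at run B's coupling `g (k+1)`
(= run A's k-th).  `T4FlagMemory.dataRenewal_sh` with the memory constant read at that coupling. [folklore] -/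
theorem sh_step_fn {Φ : ℕ → ℝ → (ℕ → X) → X} {Cf : ℝ → ℝ} {ω γ : ℝ} {src : ℕ → ℝ} {g : ℕ → ℝ}
    (hmem : StepMemoryFn Φ γ Cf ω) (hsh : StepShift Φ γ src) (hg : Adm γ g) (k : ℕ) :
    sh Φ g k ≤ src k + ∑ m ∈ range k, Cf (g (k + 1)) * ω ^ (k - m) * sh Φ g m := by
  have h1 := hsh g hg k
  have h2 := hmem k (g (k + 1)) (fun m => if m < k then entry Φ g (m + 1) else default)
    (flag Φ (fun m => g (m + 1)) k) (hg (k + 1)).1 (hg (k + 1)).2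
  have h2' : ∑ m ∈ range k, Cf (g (k + 1)) * ω ^ (k - m) *
        dist ((fun m => if m < k then entry Φ g (m + 1) else default) m) (flag Φ (fun m => g (m + 1)) k m)
      = ∑ m ∈ range k, Cf (g (k + 1)) * ω ^ (k - m) * sh Φ g m := by
    refine Finset.sum_congr rfl fun m hm => ?_
    have hmk : m < k := mem_range.mp hm
    simp only [sh]
    rw [if_pos hmk, flag_apply, if_pos hmk]
  rw [h2'] at h2
  unfold sh
  calc dist (entry Φ g (k + 1)) (entry Φ (fun m => g (m + 1)) k)
      ≤ dist (entry Φ g (k + 1)) (Φ k (g (k + 1)) (fun m => if m < k then entry Φ g (m + 1) else default))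
        + dist (Φ k (g (k + 1)) (fun m => if m < k then entry Φ g (m + 1) else default))
            (entry Φ (fun m => g (m + 1)) k) := dist_triangle _ _ _
    _ ≤ src k + ∑ m ∈ range k, Cf (g (k + 1)) * ω ^ (k - m) *
          dist (entry Φ g (m + 1)) (entry Φ (fun m => g (m + 1)) m) := by
        refine add_le_add h1 ?_
        rw [entry_def]
        exact h2

/-- **RUN-WISE SCALE SHIFT WITH THE FORWARD ENVELOPE.**  Under `StepMemoryFn Φ γ Cf ω` and `StepShift Φ γ src`
(`src ≥ 0`), along an admissible run `g` with `Cf (g (k+1)) ≤ D n` for `n ≤ k` (`D ≥ 0`):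
`sh Φ g k ≤ Σ_{i≤k} src i·ω^{k−i}·∏_{n∈]i,k]}(1 + D n)`. [folklore] -/
theorem sh_le_env {Φ : ℕ → ℝ → (ℕ → X) → X} {Cf : ℝ → ℝ} {D : ℕ → ℝ} {ω γ : ℝ} {src : ℕ → ℝ} {g : ℕ → ℝ}
    (hω : 0 ≤ ω) (hCf : ∀ x, 0 < x → x ≤ γ → 0 ≤ Cf x) (hD : ∀ n, 0 ≤ D n) (hsrc0 : ∀ k, 0 ≤ src k)
    (hmem : StepMemoryFn Φ γ Cf ω) (hsh : StepShift Φ γ src) (hg : Adm γ g)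
    (hdom : ∀ n k, n ≤ k → Cf (g (k + 1)) ≤ D n) :
    ∀ k, sh Φ g k ≤ ∑ i ∈ range (k + 1), src i * (ω ^ (k - i) * env D i k) :=
  renewal_env (M := fun k m => Cf (g (k + 1)) * ω ^ (k - m)) hω hD hsrc0
    (fun k m hmk => ⟨mul_nonneg (hCf _ (hg (k + 1)).1 (hg (k + 1)).2) (pow_nonneg hω _),
      mul_le_mul_of_nonneg_right (hdom (m + 1) k (by omega)) (pow_nonneg hω _)⟩)
    (sh_step_fn hmem hsh hg)

/-- **THE NON-INCREASING-RUN TAIL: GEOMETRIC SCALE SHIFT WITH THE GAP `(1 + ε)ω < ρ` ONLY.**  Along an admissible run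
`g` with the AF-weighted memory `Cf x = c·x` (`c ≥ 0`), NON-INCREASING couplings (`g (n+1) ≤ g n`) that are eventually
small, `c·g n ≤ ε` for `n ≥ n₀`, and geometric one-step sources `0 ≤ src k ≤ aρ^k`:
`sh Φ g k ≤ a(1 + cγ)^{n₀}ρ(ρ − (1+ε)ω)⁻¹·ρ^k` for every k — the memory gap is `(1 + ε)ω < ρ`, NOT `(1 + cγ)ω < ρ`.
ORIENTATION (v1.1, referee G-t4r3-1): this is NOT the orientation of the tree's asymptotically free runs — a run of
`FlowStep.RGEqH` with `β ≥ b > 0` on the boxes is STRICTLY INCREASING (`lt_succ_of_rgEqH_lower`, §9), so `hmono` is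
EMPTY there and v1's label «AF tail» is withdrawn (name kept for stability); on the tree's pinned runs the birth-indexed
envelope gives `sh_le_of_pinned` (§9, domination `D ≡ c·gIR`), and the ε-gap along increasing runs needs a step-indexed
envelope (sibling lineage t4-ne4-p2, not here).  (Run-wise statement; the BOX-uniform shape `ScaleShiftRate … γ β`
quantifies over all histories in ]0,γ]^{k+2}, where only the sup `cγ` is available — §3.)  HYPOTHESES ONLY; NOT summit
progress. [cite: Balaban1988RG2Cluster, (1.29) p.8; Balaban1987RG1, (0.20) p.256] -/
theorem sh_le_of_af_tail {Φ : ℕ → ℝ → (ℕ → X) → X} {c ω γ ε ρ a : ℝ} {src : ℕ → ℝ} {g : ℕ → ℝ} {n₀ : ℕ}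
    (hc : 0 ≤ c) (hω : 0 ≤ ω) (ha : 0 ≤ a) (hε : 0 ≤ ε)
    (hmem : StepMemoryFn Φ γ (fun x => c * x) ω) (hsh : StepShift Φ γ src) (hg : Adm γ g)
    (hmono : ∀ n, g (n + 1) ≤ g n) (hev : ∀ n, n₀ ≤ n → c * g n ≤ ε) (hgap : (1 + ε) * ω < ρ)
    (hsrc0 : ∀ k, 0 ≤ src k) (hsrc : ∀ k, src k ≤ a * ρ ^ k) (k : ℕ) :
    sh Φ g k ≤ a * (1 + c * γ) ^ n₀ * (ρ / (ρ - (1 + ε) * ω)) * ρ ^ k := by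
  have hD : ∀ n, 0 ≤ c * g n := fun n => mul_nonneg hc (hg n).1.le
  have hanti : ∀ n k, n ≤ k → g k ≤ g n := by
    intro n k hnk
    induction k, hnk using Nat.le_induction with
    | base => exact le_rfl
    | succ k _ ih => exact (hmono k).trans ih
  have hdom : ∀ n k, n ≤ k → c * g (k + 1) ≤ c * g n := fun n k hnk =>
    mul_le_mul_of_nonneg_left (hanti n (k + 1) (by omega)) hc
  calc sh Φ g k ≤ ∑ i ∈ range (k + 1), src i * (ω ^ (k - i) * env (fun n => c * g n) i k) :=
        sh_le_env hω (fun x hx _ => mul_nonneg hc hx.le) hD hsrc0 hmem hsh hg hdom k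
    _ ≤ a * (1 + c * γ) ^ n₀ * (ρ / (ρ - (1 + ε) * ω)) * ρ ^ k :=
        envelope_rate hω ha hD (fun n => mul_le_mul_of_nonneg_left (hg n).2 hc) hε hev hgap hsrc0 hsrc k

/-- **THE NON-INCREASING-RUN TAIL: TWO-HISTORY MODULUS AT ANY RATE ABOVE ω.**  Along admissible runs `g, g′` with run
g′ non-increasing and eventually `c·g′ n ≤ ε` (`n ≥ n₀`), under `StepDirect Φ ℓ′ γ` and the AF-weighted memory:
`dist (entry Φ g j) (entry Φ g′ j) ≤ Σ_{i≤j} ℓ′(1 + cγ)^{n₀}((1 + ε)ω)^{j−i}|g_i − g′_i|` — history moduli fading at the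
rate `(1 + ε)ω` for every ε > 0 eventually dominating the memory constants, against `(1 + cγ)ω` box-uniformly (§3).
ORIENTATION (v1.1, referee G-t4r3-1): NOT the orientation of the tree's asymptotically free runs, which INCREASE
(`lt_succ_of_rgEqH_lower`, §9; v1's label «AF tail» withdrawn, name kept); on runs bounded by their infrared coupling
see `dist_entry_le_of_pinned` (§9).  HYPOTHESES ONLY; NOT summit progress.
[cite: Balaban1988RG2Cluster, (1.29) p.8; Balaban1987RG1, §1 p.264] -/
theorem dist_entry_le_of_af_tail {Φ : ℕ → ℝ → (ℕ → X) → X} {c ℓ' ω γ ε : ℝ} {g g' : ℕ → ℝ} {n₀ : ℕ}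
    (hc : 0 ≤ c) (hℓ' : 0 ≤ ℓ') (hω : 0 ≤ ω) (hε : 0 ≤ ε)
    (hdir : StepDirect Φ ℓ' γ) (hmem : StepMemoryFn Φ γ (fun x => c * x) ω) (hg : Adm γ g) (hg' : Adm γ g')
    (hmono : ∀ n, g' (n + 1) ≤ g' n) (hev : ∀ n, n₀ ≤ n → c * g' n ≤ ε) (j : ℕ) :
    dist (entry Φ g j) (entry Φ g' j)
      ≤ ∑ i ∈ range (j + 1), ℓ' * (1 + c * γ) ^ n₀ * ((1 + ε) * ω) ^ (j - i) * |g i - g' i| := by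
  have hD : ∀ n, 0 ≤ c * g' n := fun n => mul_nonneg hc (hg' n).1.le
  have hanti : ∀ n k, n ≤ k → g' k ≤ g' n := by
    intro n k hnk
    induction k, hnk using Nat.le_induction with
    | base => exact le_rfl
    | succ k _ ih => exact (hmono k).trans ih
  have hdom : ∀ n j, n ≤ j → c * g' j ≤ c * g' n := fun n j hnj =>
    mul_le_mul_of_nonneg_left (hanti n j hnj) hc
  calc dist (entry Φ g j) (entry Φ g' j)
      ≤ ∑ i ∈ range (j + 1), ℓ' * |g i - g' i| * (ω ^ (j - i) * env (fun n => c * g' n) i j) :=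
        dist_entry_le_env hℓ' hω (fun x hx _ => mul_nonneg hc hx.le) hD hdir hmem hg hg' hdom j
    _ ≤ ∑ i ∈ range (j + 1), ℓ' * (1 + c * γ) ^ n₀ * ((1 + ε) * ω) ^ (j - i) * |g i - g' i| := by
        refine Finset.sum_le_sum fun i hi => ?_
        have hij : i ≤ j := Nat.lt_succ_iff.mp (mem_range.mp hi)
        have henv := env_le_pow_of_eventually hD (fun n => mul_le_mul_of_nonneg_left (hg' n).2 hc) hε hev hij
        calc ℓ' * |g i - g' i| * (ω ^ (j - i) * env (fun n => c * g' n) i j)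
            ≤ ℓ' * |g i - g' i| * (ω ^ (j - i) * ((1 + c * γ) ^ n₀ * (1 + ε) ^ (j - i))) :=
              mul_le_mul_of_nonneg_left (mul_le_mul_of_nonneg_left henv (pow_nonneg hω _))
                (mul_nonneg hℓ' (abs_nonneg _))
          _ = ℓ' * (1 + c * γ) ^ n₀ * ((1 + ε) * ω) ^ (j - i) * |g i - g' i| := by rw [mul_pow]; ring

end RunWise

/-! ## §7 Non-vacuity: the AF-weighted linear scheme on `ℝ` — the shapes of §3 jointly, with non-zero memory -/

section Witness

/-- A bounded 1-Lipschitz squash `y ↦ max(−1, min(1, y))` (keeps the caricature's direct modulus uniform in the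
flag). [folklore] -/
noncomputable def sq1 (y : ℝ) : ℝ := max (-1) (min 1 y)

/-- `|sq1 y| ≤ 1`. [folklore] -/
theorem abs_sq1_le (y : ℝ) : |sq1 y| ≤ 1 :=
  abs_le.mpr ⟨le_max_left _ _, max_le (by norm_num) (min_le_left _ _)⟩

/-- `sq1` is 1-Lipschitz. [folklore] -/
theorem abs_sq1_sub_le (y y' : ℝ) : |sq1 y - sq1 y'| ≤ |y - y'| := by
  unfold sq1
  calc |max (-1) (min 1 y) - max (-1) (min 1 y')| ≤ max |(-1 : ℝ) - -1| |min 1 y - min 1 y'| :=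
        abs_max_sub_max_le_max _ _ _ _
    _ ≤ max |(-1 : ℝ) - -1| (max |(1 : ℝ) - 1| |y - y'|) :=
        max_le_max le_rfl (abs_min_sub_min_le_max _ _ _ _)
    _ = |y - y'| := by simp [abs_nonneg]

/-- The AF-WEIGHTED LINEAR SCHEME on `X = ℝ`: new entry = `ℓ′·(own coupling) + Σ_{m<j} c·(own coupling)·ω^{j−m}·sq1(entry
born at m)` — memory constant PROPORTIONAL TO THE COUPLING AT WHICH THE STEP IS TAKEN (the located reading (D)); a
caricature used only to show the shapes of §3/§6 are jointly satisfiable with `c, ω > 0`. [folklore] -/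
noncomputable def afStep (ℓ' c ω : ℝ) : ℕ → ℝ → (ℕ → ℝ) → ℝ :=
  fun j g y => ℓ' * g + ∑ m ∈ range j, c * g * ω ^ (j - m) * sq1 (y m)

/-- The AF-weighted linear scheme has the coupling-weighted memory `Cf g = c·g` (`c, ω ≥ 0`; any γ). [folklore] -/
theorem afStep_memoryFn {ℓ' c ω γ : ℝ} (hc : 0 ≤ c) (hω : 0 ≤ ω) :
    StepMemoryFn (afStep ℓ' c ω) γ (fun g => c * g) ω := by
  intro j g y y' hg _
  simp only [afStep, Real.dist_eq]
  rw [show ℓ' * g + ∑ m ∈ range j, c * g * ω ^ (j - m) * sq1 (y m)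
        - (ℓ' * g + ∑ m ∈ range j, c * g * ω ^ (j - m) * sq1 (y' m))
      = ∑ m ∈ range j, c * g * ω ^ (j - m) * (sq1 (y m) - sq1 (y' m)) by
    rw [add_sub_add_left_eq_sub, ← Finset.sum_sub_distrib]
    exact Finset.sum_congr rfl fun m _ => by ring]
  refine (Finset.abs_sum_le_sum_abs _ _).trans (Finset.sum_le_sum fun m _ => ?_)
  rw [abs_mul, abs_of_nonneg (mul_nonneg (mul_nonneg hc hg.le) (pow_nonneg hω _))]
  exact mul_le_mul_of_nonneg_left (abs_sq1_sub_le _ _) (mul_nonneg (mul_nonneg hc hg.le) (pow_nonneg hω _))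

/-- `Σ_{m<j} ω^{j−m} ≤ ω(1−ω)⁻¹` for `0 ≤ ω < 1`. [folklore] -/
theorem sum_pow_sub_le {ω : ℝ} (hω : 0 ≤ ω) (hω1 : ω < 1) (j : ℕ) :
    ∑ m ∈ range j, ω ^ (j - m) ≤ ω / (1 - ω) := by
  have h1ω : 0 < 1 - ω := sub_pos.mpr hω1
  have hre : ∑ m ∈ range j, ω ^ (j - m) = ω * ∑ n ∈ range j, ω ^ n := by
    rw [Finset.mul_sum, ← Finset.sum_range_reflect (fun n => ω * ω ^ n) j]
    refine Finset.sum_congr rfl fun m hm => ?_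
    have hmj := mem_range.mp hm
    rw [← pow_succ', show j - 1 - m + 1 = j - m by omega]
  have hgeom : (∑ n ∈ range j, ω ^ n) * (1 - ω) = 1 - ω ^ j := by
    have h := geom_sum_mul ω j
    linear_combination (-1 : ℝ) * h
  have hsum : ∑ n ∈ range j, ω ^ n ≤ 1 / (1 - ω) := by
    rw [le_div_iff₀ h1ω, hgeom]
    linarith [pow_nonneg hω j]
  rw [hre]
  calc ω * ∑ n ∈ range j, ω ^ n ≤ ω * (1 / (1 - ω)) := mul_le_mul_of_nonneg_left hsum hω
    _ = ω / (1 - ω) := by rw [mul_one_div]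

/-- The AF-weighted linear scheme has a direct modulus `ℓ′ + cω(1−ω)⁻¹`, uniformly in the step and the flag
(`ℓ′, c ≥ 0`, `0 ≤ ω < 1`; any γ). [folklore] -/
theorem afStep_direct {ℓ' c ω γ : ℝ} (hℓ' : 0 ≤ ℓ') (hc : 0 ≤ c) (hω : 0 ≤ ω) (hω1 : ω < 1) :
    StepDirect (afStep ℓ' c ω) (ℓ' + c * (ω / (1 - ω))) γ := by
  intro j g g' y _ _ _ _
  simp only [afStep, Real.dist_eq]
  set T := ∑ m ∈ range j, ω ^ (j - m) * sq1 (y m) with hT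
  have hsumg : ∀ x : ℝ, ∑ m ∈ range j, c * x * ω ^ (j - m) * sq1 (y m) = c * x * T := by
    intro x
    rw [hT, Finset.mul_sum]
    exact Finset.sum_congr rfl fun m _ => by ring
  rw [hsumg g, hsumg g', show ℓ' * g + c * g * T - (ℓ' * g' + c * g' * T) = (ℓ' + c * T) * (g - g') by ring,
    abs_mul]
  refine mul_le_mul_of_nonneg_right ?_ (abs_nonneg _)
  have hTle : |T| ≤ ω / (1 - ω) := by
    rw [hT]
    refine (Finset.abs_sum_le_sum_abs _ _).trans ((Finset.sum_le_sum fun m _ => ?_).trans (sum_pow_sub_le hω hω1 j))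
    rw [abs_mul, abs_of_nonneg (pow_nonneg hω _)]
    calc ω ^ (j - m) * |sq1 (y m)| ≤ ω ^ (j - m) * 1 := mul_le_mul_of_nonneg_left (abs_sq1_le _) (pow_nonneg hω _)
      _ = ω ^ (j - m) := mul_one _
  calc |ℓ' + c * T| ≤ |ℓ'| + |c * T| := abs_add_le _ _
    _ = ℓ' + c * |T| := by rw [abs_of_nonneg hℓ', abs_mul, abs_of_nonneg hc]
    _ ≤ ℓ' + c * (ω / (1 - ω)) := add_le_add le_rfl (mul_le_mul_of_nonneg_left hTle hc)

/-- THE ONE-STEP SOURCE OF THE AF-WEIGHTED LINEAR SCHEME: run B's entry born at `k + 1` minus what the step-k map makes of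
run B's shifted flag at the same coupling is `c·g_{k+1}·ω^{k+1}·sq1(entry 0)` — every partnered entry cancels, the
unpartnered finest one survives with the weight of its age AND of the current coupling. [folklore] -/
theorem afStep_shift_eq (ℓ' c ω : ℝ) (g : ℕ → ℝ) (k : ℕ) :
    entry (afStep ℓ' c ω) g (k + 1)
      - afStep ℓ' c ω k (g (k + 1)) (fun m => if m < k then entry (afStep ℓ' c ω) g (m + 1) else default)
      = c * g (k + 1) * ω ^ (k + 1) * sq1 (entry (afStep ℓ' c ω) g 0) := by
  rw [entry_def]
  simp only [afStep]
  have hflag : ∑ m ∈ range (k + 1), c * g (k + 1) * ω ^ (k + 1 - m) * sq1 (flag (afStep ℓ' c ω) g (k + 1) m)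
      = ∑ m ∈ range (k + 1), c * g (k + 1) * ω ^ (k + 1 - m) * sq1 (entry (afStep ℓ' c ω) g m) := by
    refine Finset.sum_congr rfl fun m hm => ?_
    rw [flag_apply, if_pos (mem_range.mp hm)]
  have hsh : ∑ m ∈ range k, c * g (k + 1) * ω ^ (k - m)
        * sq1 (if m < k then entry (afStep ℓ' c ω) g (m + 1) else default)
      = ∑ m ∈ range k, c * g (k + 1) * ω ^ (k + 1 - (m + 1)) * sq1 (entry (afStep ℓ' c ω) g (m + 1)) := by
    refine Finset.sum_congr rfl fun m hm => ?_
    rw [if_pos (mem_range.mp hm), show k + 1 - (m + 1) = k - m by omega]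
  change ℓ' * g (k + 1) + ∑ m ∈ range (k + 1), c * g (k + 1) * ω ^ (k + 1 - m) * sq1 (flag (afStep ℓ' c ω) g (k + 1) m)
      - (ℓ' * g (k + 1) + ∑ m ∈ range k, c * g (k + 1) * ω ^ (k - m)
          * sq1 (if m < k then entry (afStep ℓ' c ω) g (m + 1) else default))
      = c * g (k + 1) * ω ^ (k + 1) * sq1 (entry (afStep ℓ' c ω) g 0)
  rw [hflag, hsh,
    Finset.sum_range_succ' (fun m => c * g (k + 1) * ω ^ (k + 1 - m) * sq1 (entry (afStep ℓ' c ω) g m))]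
  simp only [Nat.sub_zero]
  ring

/-- Hence the AF-weighted linear scheme satisfies `StepShift` with the geometric source `src k = (cγω)·ω^k` along
admissible sequences (`|sq1| ≤ 1`, `0 < g_{k+1} ≤ γ`; `c, ω ≥ 0`). [folklore] -/
theorem afStep_shift {ℓ' c ω γ : ℝ} (hc : 0 ≤ c) (hω : 0 ≤ ω) :
    StepShift (afStep ℓ' c ω) γ (fun k => c * γ * ω * ω ^ k) := by
  intro g hg k
  rw [Real.dist_eq, afStep_shift_eq, abs_mul,
    abs_of_nonneg (mul_nonneg (mul_nonneg hc (hg (k + 1)).1.le) (pow_nonneg hω _))]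
  have h1 : c * g (k + 1) * ω ^ (k + 1) ≤ c * γ * ω ^ (k + 1) :=
    mul_le_mul_of_nonneg_right (mul_le_mul_of_nonneg_left (hg (k + 1)).2 hc) (pow_nonneg hω _)
  have h2 : 0 ≤ c * g (k + 1) * ω ^ (k + 1) := mul_nonneg (mul_nonneg hc (hg (k + 1)).1.le) (pow_nonneg hω _)
  calc c * g (k + 1) * ω ^ (k + 1) * |sq1 (entry (afStep ℓ' c ω) g 0)|
      ≤ c * γ * ω ^ (k + 1) * 1 := mul_le_mul h1 (abs_sq1_le _) (abs_nonneg _) (h2.trans h1)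
    _ = c * γ * ω * ω ^ k := by rw [pow_succ]; ring

/-- NON-VACUITY OF §3 WITH NON-ZERO AF-WEIGHTED MEMORY: the β-family read off the AF-weighted linear scheme,
`βaf k v = entry (afStep ℓ′ c ω) (extd v) k`, satisfies node U2's three inputs with the constants of `ne4_of_scheme_af`
(`cr = 1`, direct modulus `ℓ′ + cω(1−ω)⁻¹`, `a = cγω`) as soon as `(1 + cγ)ω < ρ` (`ℓ′, c ≥ 0`, `0 ≤ ω < 1`, `γ > 0`).
[folklore] -/
theorem ne4_afStep {ℓ' c ω γ ρ : ℝ} (hℓ' : 0 ≤ ℓ') (hc : 0 ≤ c) (hω : 0 ≤ ω) (hω1 : ω < 1) (hγ : 0 < γ)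
    (hsmall : (1 + c * γ) * ω < ρ) :
    ScaleShiftRate (1 * (c * γ * ω * (ρ - ω) / (ρ - (1 + c * γ) * ω))) ρ γ
        (fun k v => entry (afStep ℓ' c ω) (extd v) k) ∧
    HistLipschitz (fun k i => 1 * (ℓ' + c * (ω / (1 - ω))) * ((1 + c * γ) * ω) ^ (k - i)) γ
        (fun k v => entry (afStep ℓ' c ω) (extd v) k) ∧
    FadingMemory (1 * (ℓ' + c * (ω / (1 - ω)))) ρ
        (fun k i => 1 * (ℓ' + c * (ω / (1 - ω))) * ((1 + c * γ) * ω) ^ (k - i)) := by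
  have hων : ω ≤ (1 + c * γ) * ω := by nlinarith [mul_nonneg hc hγ.le]
  have hωρ : ω ≤ ρ := hων.trans hsmall.le
  have hℓ'' : 0 ≤ ℓ' + c * (ω / (1 - ω)) := add_nonneg hℓ' (mul_nonneg hc (div_nonneg hω (sub_pos.mpr hω1).le))
  refine ne4_of_scheme_af (r := fun x : ℝ => x) (src := fun k => c * γ * ω * ω ^ k) hγ hℓ'' hc hω zero_le_one
    (mul_nonneg (mul_nonneg hc hγ.le) hω) hsmall (fun k v _ => rfl) readLipschitz_id
    (afStep_direct hℓ' hc hω hω1) (afStep_memoryFn hc hω) (afStep_shift hc hω) ?_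
  intro k
  exact mul_le_mul_of_nonneg_left (pow_le_pow_left₀ hω hωρ k) (mul_nonneg (mul_nonneg hc hγ.le) hω)

end Witness

/-! ## §8 Where the coupling weight sits: the activity-level insertion carries `g_k` ([II] (1.24), verbatim) -/

section Factor

variable {X : Type*} [PseudoMetricSpace X] {A : Type*} [PseudoMetricSpace A]

/-- HYPOTHESIS SHAPE (PRINTED STRUCTURE with a verbatim `g_k` factor, printed-TYPE constant): ACTIVITY-LEVEL INSERTION
WITH AGE FACTOR AND COUPLING WEIGHT — at an admissible coupling `g` the step-j activities depend on the entry born at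
`m < j` with modulus `Cf g·ω^{j−m}`.  [II] (1.24) p. 8 bounds each term (1.23) of the fluctuation-field action (LINEAR in
the old terms, (1.33) p. 9) by «8B₀C₁e^{16κ₁}α₂⁻¹ g_k|B| E₀(α₁/α₃)⁵(L^jη)⁵ …» — the factor `g_k|B|` (current coupling ×
fluctuation field) and one age factor `L^jη` per old scale are VERBATIM; print then replaces `g_k|B|` by `ε₁` ((1.29)) and
remarks «Another possibility is to use the expression g_k|B| instead of ε₁. It gives a better bound» (p. 8).  Carrying the
factor `g_k` to a modulus is the [analysis] reading (D) of the header; no NUMBER is printed.  `T4FlagMemory.ActInsertion`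
is the constant-profile case. [cite: Balaban1988RG2Cluster, (1.24) p.8 and (1.33) p.9] -/
def ActInsertionFn (act : ℕ → ℝ → (ℕ → X) → A) (γ : ℝ) (Cf : ℝ → ℝ) (ω : ℝ) : Prop :=
  ∀ j (g : ℝ) (y y' : ℕ → X), 0 < g → g ≤ γ →
    dist (act j g y) (act j g y') ≤ ∑ m ∈ range j, Cf g * ω ^ (j - m) * dist (y m) (y' m)

/-- **THE COUPLING-WEIGHTED MEMORY FROM ITS TWO LOCATED HALVES.**  (lin) `ActInsertionFn act γ Cf ω` + (val)
`T4FlagMemory.ActToValue val KV` (`KV ≥ 0`; kernel in kind: `T4ActivityLipschitz`, cited BY NAME in `T4FlagMemory` §6)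
⇒ `StepMemoryFn (factorStep act val) γ (KV·Cf) ω` — with `Cf g = c·g` the AF-weighted memory of §3/§6 with constant
`KV·c`.  Composition of two Lipschitz bounds; bookkeeping. [folklore] -/
theorem stepMemoryFn_of_factor {act : ℕ → ℝ → (ℕ → X) → A} {val : ℕ → ℝ → A → X} {Cf : ℝ → ℝ} {γ ω KV : ℝ}
    (hKV : 0 ≤ KV) (hins : ActInsertionFn act γ Cf ω) (hval : ActToValue val KV) :
    StepMemoryFn (factorStep act val) γ (fun g => KV * Cf g) ω := by
  intro j g y y' hg0 hgγ
  show dist (val j g (act j g y)) (val j g (act j g y')) ≤ _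
  calc dist (val j g (act j g y)) (val j g (act j g y'))
      ≤ KV * dist (act j g y) (act j g y') := hval j g _ _
    _ ≤ KV * ∑ m ∈ range j, Cf g * ω ^ (j - m) * dist (y m) (y' m) :=
        mul_le_mul_of_nonneg_left (hins j g y y' hg0 hgγ) hKV
    _ = ∑ m ∈ range j, KV * Cf g * ω ^ (j - m) * dist (y m) (y' m) := by
        rw [Finset.mul_sum]
        exact Finset.sum_congr rfl fun m _ => by ring

end Factor

/-! ## §9 (v1.1) ORIENTATION of the runs of (0.20), and the γ-currency on the INFRARED-PINNED runs = the
renormalized-coupling currency -/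

section Orientation

/-- **RUNS OF (0.20) ARE NON-DECREASING UNDER THE SIGN OF β.**  In the tree's convention (index 0 = the FINEST
coupling; `FlowStep.RGEqH`: `1/(g k)² = 1/(g (k+1))² + β k (g 0,…,g k)`), if `β k ≥ 0` on the boxes from step `k₀` on
(`EventualLowerH 0 γ k₀ β` — the SIGN only), then along a run in the box ]0,γ] the couplings do not decrease from `k₀`
on: `g k ≤ g (k+1)` for `k₀ ≤ k < K`.  This is the orientation of the lower half of [I] (0.31),
«1/g² + β log(L^kε)^{−1} ≤ 1/g_k²» (g = g_K the renormalized coupling): the couplings grow towards the infrared pin.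
[cite: Balaban1987RG1, Thm 2 (0.31) p.259] -/
theorem le_succ_of_rgEqH_sign {β : HBeta} {γ : ℝ} {k₀ K : ℕ} {g : ℕ → ℝ} (hrun : RGEqH K β g)
    (hbox : ∀ i, i ≤ K → 0 < g i ∧ g i ≤ γ) (hsign : EventualLowerH 0 γ k₀ β) {k : ℕ} (hk₀ : k₀ ≤ k)
    (hk : k < K) : g k ≤ g (k + 1) := by
  have h0 : 0 < g k := (hbox k hk.le).1
  have h1 : 0 < g (k + 1) := (hbox (k + 1) hk).1
  have hβ : 0 ≤ β k (prefixOf g k) :=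
    hsign k (prefixOf g k) hk₀ (T4CouplingMatching.prefixOf_mem_box hk.le hbox)
  have hinv : 1 / (g (k + 1)) ^ 2 ≤ 1 / (g k) ^ 2 := by rw [hrun k hk]; linarith
  have hsq : (g k) ^ 2 ≤ (g (k + 1)) ^ 2 := (one_div_le_one_div (pow_pos h1 2) (pow_pos h0 2)).mp hinv
  exact (pow_le_pow_iff_left₀ h0.le h1.le two_ne_zero).mp hsq

/-- … hence `g i ≤ g j` for `k₀ ≤ i ≤ j ≤ K`. [cite: Balaban1987RG1, Thm 2 (0.31) p.259] -/
theorem mono_of_rgEqH_sign {β : HBeta} {γ : ℝ} {k₀ K : ℕ} {g : ℕ → ℝ} (hrun : RGEqH K β g)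
    (hbox : ∀ i, i ≤ K → 0 < g i ∧ g i ≤ γ) (hsign : EventualLowerH 0 γ k₀ β) {i j : ℕ} (hk₀ : k₀ ≤ i)
    (hij : i ≤ j) (hj : j ≤ K) : g i ≤ g j := by
  induction j, hij using Nat.le_induction with
  | base => exact le_rfl
  | succ j hij ih =>
      exact (ih (Nat.le_of_succ_le hj)).trans
        (le_succ_of_rgEqH_sign hrun hbox hsign (hk₀.trans hij) (Nat.lt_of_succ_le hj))

/-- **A PINNED RUN LIES IN THE BOX OF ITS INFRARED COUPLING.**  Under the sign `β ≥ 0` on the boxes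
(`BetaLowerH 0 γ β`) every coupling of a run of (0.20) in ]0,γ] is at most its last one: `0 < g i ≤ g K` (= the
renormalized coupling g of [I] Thm 2, «g_K = g»).  [cite: Balaban1987RG1, Thm 2 (0.31) p.259] -/
theorem box_last_of_rgEqH_sign {β : HBeta} {γ : ℝ} {K : ℕ} {g : ℕ → ℝ} (hrun : RGEqH K β g)
    (hbox : ∀ i, i ≤ K → 0 < g i ∧ g i ≤ γ) (hsign : BetaLowerH 0 γ β) :
    ∀ i, i ≤ K → 0 < g i ∧ g i ≤ g K := fun i hi =>
  ⟨(hbox i hi).1, mono_of_rgEqH_sign (k₀ := 0) hrun hbox (fun k v _ hv => hsign k v hv) (Nat.zero_le i) hi le_rfl⟩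

/-- **THE ORIENTATION WITNESS** (referee objection G-t4r3-1, t4-ref3-g5: its `hmono_incompatible_with_AF`, reproduced).
With a POSITIVE lower bound `β ≥ b > 0` from step `k₀` on — the cell's asymptotic-freedom input (T09.F /
`EventualLowerH b`) — a run of (0.20) is STRICTLY increasing from `k₀` on; in particular the hypothesis
`∀ n, g (n+1) ≤ g n` of §6's non-increasing corollaries FAILS on every such run with `k₀ < K`: those corollaries are
true as typed but EMPTY on the tree's asymptotically free runs. [cite: Balaban1987RG1, Thm 2 (0.31) p.259] -/
theorem lt_succ_of_rgEqH_lower {β : HBeta} {γ b : ℝ} {k₀ K : ℕ} {g : ℕ → ℝ} (hb : 0 < b) (hrun : RGEqH K β g)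
    (hbox : ∀ i, i ≤ K → 0 < g i ∧ g i ≤ γ) (hlo : EventualLowerH b γ k₀ β) {k : ℕ} (hk₀ : k₀ ≤ k)
    (hk : k < K) : g k < g (k + 1) := by
  have h0 : 0 < g k := (hbox k hk.le).1
  have h1 : 0 < g (k + 1) := (hbox (k + 1) hk).1
  have hβ : b ≤ β k (prefixOf g k) :=
    hlo k (prefixOf g k) hk₀ (T4CouplingMatching.prefixOf_mem_box hk.le hbox)
  have hinv : 1 / (g (k + 1)) ^ 2 < 1 / (g k) ^ 2 := by rw [hrun k hk]; linarith
  have hsq : (g k) ^ 2 < (g (k + 1)) ^ 2 := (one_div_lt_one_div (pow_pos h1 2) (pow_pos h0 2)).mp hinv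
  exact (pow_lt_pow_iff_left₀ h0.le h1.le two_ne_zero).mp hsq

/-- … so NO asymptotically free run of positive length is non-increasing (the §6 hypothesis set `hmono` is empty
there). [cite: Balaban1987RG1, Thm 2 (0.31) p.259] -/
theorem not_antitone_of_rgEqH_lower {β : HBeta} {γ b : ℝ} {k₀ K : ℕ} {g : ℕ → ℝ} (hb : 0 < b)
    (hrun : RGEqH K β g) (hbox : ∀ i, i ≤ K → 0 < g i ∧ g i ≤ γ) (hlo : EventualLowerH b γ k₀ β)
    (hK : k₀ < K) (hmono : ∀ n, g (n + 1) ≤ g n) : False :=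
  absurd (hmono k₀) (not_le.mpr (lt_succ_of_rgEqH_lower hb hrun hbox hlo le_rfl hK))

end Orientation

section BoxMonotone

variable {X : Type*}

/-- The box ]0,γ′] sits inside ]0,γ] for `γ′ ≤ γ`. [folklore] -/
theorem mem_box_mono {γ γ' : ℝ} (hle : γ' ≤ γ) {k : ℕ} {v : Fin (k + 1) → ℝ} (hv : v ∈ Box γ' k) :
    v ∈ Box γ k :=
  mem_box.mpr fun i => ⟨(mem_box.mp hv i).1, (mem_box.mp hv i).2.trans hle⟩

/-- Admissibility is monotone in the box parameter. [folklore] -/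
theorem adm_mono {γ γ' : ℝ} (hle : γ' ≤ γ) {g : ℕ → ℝ} (hg : Adm γ' g) : Adm γ g :=
  fun m => ⟨(hg m).1, (hg m).2.trans hle⟩

/-- An eventual lower bound on the larger boxes restricts to the smaller ones. [folklore] -/
theorem eventualLowerH_mono {b γ γ' : ℝ} {k₀ : ℕ} {β : HBeta} (hle : γ' ≤ γ) (h : EventualLowerH b γ k₀ β) :
    EventualLowerH b γ' k₀ β :=
  fun k v hk hv => h k v hk (mem_box_mono hle hv)

/-- Representation restricts to a smaller box. [folklore] -/
theorem represents_mono [Inhabited X] {Φ : ℕ → ℝ → (ℕ → X) → X} {r : X → ℝ} {γ γ' : ℝ} {β : HBeta}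
    (hle : γ' ≤ γ) (h : Represents Φ r γ β) : Represents Φ r γ' β :=
  fun k v hv => h k v (mem_box_mono hle hv)

/-- The coupling-weighted memory shape restricts to a smaller box. [folklore] -/
theorem stepMemoryFn_mono [PseudoMetricSpace X] {Φ : ℕ → ℝ → (ℕ → X) → X} {Cf : ℝ → ℝ} {ω γ γ' : ℝ}
    (hle : γ' ≤ γ) (h : StepMemoryFn Φ γ Cf ω) : StepMemoryFn Φ γ' Cf ω :=
  fun j g y y' hg0 hgγ => h j g y y' hg0 (hgγ.trans hle)

/-- The direct coupling dependence restricts to a smaller box. [folklore] -/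
theorem stepDirect_mono [PseudoMetricSpace X] {Φ : ℕ → ℝ → (ℕ → X) → X} {ℓ' γ γ' : ℝ} (hle : γ' ≤ γ)
    (h : StepDirect Φ ℓ' γ) : StepDirect Φ ℓ' γ' :=
  fun j g g' y hg0 hg hg0' hg' => h j g g' y hg0 (hg.trans hle) hg0' (hg'.trans hle)

/-- The one-step shift source restricts to a smaller box. [folklore] -/
theorem stepShift_mono [PseudoMetricSpace X] [Inhabited X] {Φ : ℕ → ℝ → (ℕ → X) → X} {γ γ' : ℝ}
    {src : ℕ → ℝ} (hle : γ' ≤ γ) (h : StepShift Φ γ src) : StepShift Φ γ' src :=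
  fun g hg k => h g (adm_mono hle hg) k

end BoxMonotone

section Pinned

variable {X : Type*} [PseudoMetricSpace X] [Inhabited X]

/-- **NODE U2's SPINE OUTPUT IN THE RENORMALIZED-COUPLING CURRENCY (two-run closure).**
`injectedRate_of_scheme_twoRun_af` read on the INFRARED-PINNED runs of (0.20): under the mere SIGN `β ≥ 0` on the boxes
(`BetaLowerH 0 γ β`) every coupling of the run pinned at `g_K = gIR` lies in ]0, gIR] (`box_last_of_rgEqH_sign`; the
lower half of (0.31)), the scheme shapes restrict to that box, and the γ-currency statement holds with `γ ↦ gIR`: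
K-uniform `T4CauchySum.InjectedRate (2(2c₀ + cr·a·κ)(1−ρ)⁻¹) 0 ρ (fun K j ↦ disc (g K) (g (K+1)) j)`,
`κ = (ρ−ω)(ρ−(1+c·gIR)ω)⁻¹`, under the memory gap `(1 + c·gIR)ω < ρ < 1`, (AF-0r) and the gain window
`cr·ℓ′·gIR³·κ ≤ (1−ρ)/2` — BOTH windows are smallness conditions on the RENORMALIZED COUPLING `gIR` = print's g
(«for a sufficiently small positive g», Thm 2), NOT on the box parameter γ; no `b > 0`, no exceptional-step count.
HONEST LIMITS: the memory gap is `(1 + c·gIR)L⁻¹ < ρ` in print's currency, not the `(1 + ε)L⁻¹`-gap of the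
ultraviolet-sparse reading (sibling lineage t4-ne4-p2, `T4TwoRunAfTail`); every input is an UNPRINTED hypothesis
shape or binder; rung (B)+1 finite-torus bookkeeping, NOT summit progress.
[cite: Balaban1987RG1, (0.20) p.256 and Thm 2 (0.31) p.259] -/
theorem injectedRate_of_scheme_twoRun_af_pinned {β : HBeta} (S : B12Beta.OneLoopSplit β)
    {Φ : ℕ → ℝ → (ℕ → X) → X} {r : X → ℝ} {src : ℕ → ℝ} {ℓ' c ω γ cr a ρ binf c₀ : ℝ} (g : ℕ → ℕ → ℝ)
    (gIR : ℝ) (hρ1 : ρ < 1) (hω : 0 ≤ ω) (hc : 0 ≤ c) (hsmall : (1 + c * gIR) * ω < ρ)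
    (hc₀ : 0 ≤ c₀) (ha : 0 ≤ a) (hℓ' : 0 ≤ ℓ') (hcr : 0 ≤ cr)
    (hrep : Represents Φ r γ S.β1) (hr : ReadLipschitz r cr) (hdir : StepDirect Φ ℓ' γ)
    (hmem : StepMemoryFn Φ γ (fun g => c * g) ω) (hsh : StepShift Φ γ src)
    (hsrc : ∀ k, src k ≤ a * ρ ^ k)
    (hrun : ∀ K, RGEqH K β (g K)) (hbox : ∀ K i, i ≤ K → 0 < g K i ∧ g K i ≤ γ) (hpin : ∀ K, g K K = gIR)
    (hsign : BetaLowerH 0 γ β)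
    (hconv : ∀ k, |S.β0 k - binf| ≤ c₀ * ρ ^ k)
    (hgain : cr * (ℓ' * gIR ^ 3) * ((ρ - ω) / (ρ - (1 + c * gIR) * ω)) ≤ (1 - ρ) / 2) :
    T4CauchySum.InjectedRate (2 * (2 * c₀ + cr * a * ((ρ - ω) / (ρ - (1 + c * gIR) * ω))) / (1 - ρ)) 0 ρ
      (fun K j => disc (g K) (g (K + 1)) j) := by
  have hIR : 0 < gIR := (hpin 0) ▸ (hbox 0 0 le_rfl).1
  have hIRγ : gIR ≤ γ := (hpin 0) ▸ (hbox 0 0 le_rfl).2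
  have hboxIR : ∀ K i, i ≤ K → 0 < g K i ∧ g K i ≤ gIR := fun K i hi =>
    (hpin K) ▸ box_last_of_rgEqH_sign (hrun K) (hbox K) hsign i hi
  exact injectedRate_of_scheme_twoRun_af S g gIR hIR hρ1 hω hc hsmall hc₀ ha hℓ' hcr (represents_mono hIRγ hrep)
    hr (stepDirect_mono hIRγ hdir) (stepMemoryFn_mono hIRγ hmem) (stepShift_mono hIRγ hsh) hsrc hrun hboxIR hpin
    hconv hgain

/-- **NODE U2's SPINE OUTPUT IN THE RENORMALIZED-COUPLING CURRENCY (box-uniform closure, for comparison).**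
`T4FlagMemoryTwoRun.injectedRate_of_split_scheme_eventual` with the AF-weighted memory clamped to the box ]0, gIR] of
the pinned runs: remaining conditionals (AF-0r), the eventual lower bound `EventualLowerH b γ k₀ β` (`b > 0`, which
also gives the sign used for the pinning box only from `k₀` on — so here the all-k sign `BetaLowerH 0 γ β` is asked
separately), the memory gap `(1 + c·gIR)ω < ρ < 1` and the window `cr·ℓ′·((k₀+1)gIR³ + 2gIR/b) ≤ (1−ρ)/2` — again
conditions on gIR, not on γ.  Bookkeeping over UNPRINTED inputs; NOT summit progress.
[cite: Balaban1987RG1, (0.20) p.256 and Thm 2 (0.31) p.259] -/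
theorem injectedRate_of_split_scheme_eventual_af_pinned {β : HBeta} (S : B12Beta.OneLoopSplit β)
    {Φ : ℕ → ℝ → (ℕ → X) → X} {r : X → ℝ} {src : ℕ → ℝ} {ℓ' c ω γ cr a ρ b binf c₀ : ℝ} {k₀ : ℕ}
    (g : ℕ → ℕ → ℝ) (gIR : ℝ) (hb : 0 < b) (hρ1 : ρ < 1) (hℓ' : 0 ≤ ℓ') (hc : 0 ≤ c) (hω : 0 ≤ ω)
    (hcr : 0 ≤ cr) (ha : 0 ≤ a) (hc₀ : 0 ≤ c₀) (hsmall : (1 + c * gIR) * ω < ρ)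
    (hconv : ∀ k, |S.β0 k - binf| ≤ c₀ * ρ ^ k)
    (hrep : Represents Φ r γ S.β1) (hr : ReadLipschitz r cr) (hdir : StepDirect Φ ℓ' γ)
    (hmem : StepMemoryFn Φ γ (fun g => c * g) ω) (hsh : StepShift Φ γ src) (hsrc : ∀ k, src k ≤ a * ρ ^ k)
    (hrun : ∀ K, RGEqH K β (g K)) (hbox : ∀ K i, i ≤ K → 0 < g K i ∧ g K i ≤ γ) (hpin : ∀ K, g K K = gIR)
    (hsign : BetaLowerH 0 γ β) (hlo : EventualLowerH b γ k₀ β)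
    (hsmall₂ : cr * ℓ' * (((k₀ : ℝ) + 1) * gIR ^ 3 + 2 * gIR / b) ≤ (1 - ρ) / 2) :
    T4CauchySum.InjectedRate (2 * (2 * c₀ + cr * (a * (ρ - ω) / (ρ - (1 + c * gIR) * ω))) / (1 - ρ)) 0 ρ
      (fun K j => disc (g K) (g (K + 1)) j) := by
  have hIR : 0 < gIR := (hpin 0) ▸ (hbox 0 0 le_rfl).1
  have hIRγ : gIR ≤ γ := (hpin 0) ▸ (hbox 0 0 le_rfl).2
  have hboxIR : ∀ K i, i ≤ K → 0 < g K i ∧ g K i ≤ gIR := fun K i hi =>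
    (hpin K) ▸ box_last_of_rgEqH_sign (hrun K) (hbox K) hsign i hi
  have hcIR : 0 ≤ c * gIR := mul_nonneg hc hIR.le
  exact injectedRate_of_split_scheme_eventual S g gIR hIR hb hρ1 hℓ' hcIR hω hcr ha hc₀ hsmall hconv
    (represents_clampStep (represents_mono hIRγ hrep)) hr (stepDirect_clampStep (stepDirect_mono hIRγ hdir))
    (stepMemory_clampStep hIR (stepMemoryAdm_of_fn hω (fun _ _ hg => mul_le_mul_of_nonneg_left hg hc)
      (stepMemoryFn_mono hIRγ hmem)))
    (fadingMemory_profile hcIR hω) (stepShift_clampStep (stepShift_mono hIRγ hsh)) hsrc hrun hboxIR hpin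
    (eventualLowerH_mono hIRγ hlo) hsmall₂

/-- **THE RUN-WISE SCALE SHIFT ON A RUN BOUNDED BY ITS INFRARED COUPLING** (what the birth-indexed forward envelope of
§5–§6 gives on the tree's INCREASING runs: the domination `D ≡ c·gIR`).  Along an admissible run in ]0, gIR] with the
AF-weighted memory and geometric sources `0 ≤ src k ≤ aρ^k`: `sh Φ g k ≤ a·ρ(ρ − (1 + c·gIR)ω)⁻¹·ρ^k` under the gap
`(1 + c·gIR)ω < ρ`.  (`sh_le_env` + `envelope_rate` with `n₀ = 0`; equivalently §3 box-uniformly on the box ]0, gIR].)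
HYPOTHESES ONLY; NOT summit progress. [cite: Balaban1987RG1, (0.20) p.256 and Thm 2 (0.31) p.259] -/
theorem sh_le_of_pinned {Φ : ℕ → ℝ → (ℕ → X) → X} {c ω gIR ρ a : ℝ} {src : ℕ → ℝ} {g : ℕ → ℝ}
    (hc : 0 ≤ c) (hω : 0 ≤ ω) (ha : 0 ≤ a)
    (hmem : StepMemoryFn Φ gIR (fun x => c * x) ω) (hsh : StepShift Φ gIR src) (hg : Adm gIR g)
    (hgap : (1 + c * gIR) * ω < ρ) (hsrc0 : ∀ k, 0 ≤ src k) (hsrc : ∀ k, src k ≤ a * ρ ^ k) (k : ℕ) :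
    sh Φ g k ≤ a * (ρ / (ρ - (1 + c * gIR) * ω)) * ρ ^ k := by
  have hD : ∀ _n : ℕ, 0 ≤ c * gIR := fun _ => mul_nonneg hc ((hg 0).1.le.trans (hg 0).2)
  have hdom : ∀ n k, n ≤ k → c * g (k + 1) ≤ c * gIR := fun n k _ => mul_le_mul_of_nonneg_left (hg (k + 1)).2 hc
  calc sh Φ g k ≤ ∑ i ∈ range (k + 1), src i * (ω ^ (k - i) * env (fun _ => c * gIR) i k) :=
        sh_le_env hω (fun x hx _ => mul_nonneg hc hx.le) hD hsrc0 hmem hsh hg hdom k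
    _ ≤ a * (1 + c * gIR) ^ 0 * (ρ / (ρ - (1 + c * gIR) * ω)) * ρ ^ k :=
        envelope_rate (n₀ := 0) hω ha hD (fun _ => le_rfl) (hD 0) (fun _ _ => le_rfl) hgap hsrc0 hsrc k
    _ = a * (ρ / (ρ - (1 + c * gIR) * ω)) * ρ ^ k := by rw [pow_zero, mul_one]

/-- **THE RUN-WISE TWO-HISTORY MODULUS ON RUNS BOUNDED BY THE INFRARED COUPLING.**  Along admissible runs `g, g′` in
]0, gIR], under `StepDirect Φ ℓ′ gIR` and the AF-weighted memory:
`dist (entry Φ g j) (entry Φ g′ j) ≤ Σ_{i≤j} ℓ′((1 + c·gIR)ω)^{j−i}|g_i − g′_i|` (`dist_entry_le_env` with `D ≡ c·gIR`,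
`env_const`).  HYPOTHESES ONLY; NOT summit progress. [cite: Balaban1987RG1, §1 p.264 and Thm 2 (0.31) p.259] -/
theorem dist_entry_le_of_pinned {Φ : ℕ → ℝ → (ℕ → X) → X} {c ℓ' ω gIR : ℝ} {g g' : ℕ → ℝ}
    (hc : 0 ≤ c) (hℓ' : 0 ≤ ℓ') (hω : 0 ≤ ω)
    (hdir : StepDirect Φ ℓ' gIR) (hmem : StepMemoryFn Φ gIR (fun x => c * x) ω) (hg : Adm gIR g)
    (hg' : Adm gIR g') (j : ℕ) :
    dist (entry Φ g j) (entry Φ g' j)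
      ≤ ∑ i ∈ range (j + 1), ℓ' * ((1 + c * gIR) * ω) ^ (j - i) * |g i - g' i| := by
  have hD : ∀ _n : ℕ, 0 ≤ c * gIR := fun _ => mul_nonneg hc ((hg' 0).1.le.trans (hg' 0).2)
  have hdom : ∀ n j, n ≤ j → c * g' j ≤ c * gIR := fun n j _ => mul_le_mul_of_nonneg_left (hg' j).2 hc
  calc dist (entry Φ g j) (entry Φ g' j)
      ≤ ∑ i ∈ range (j + 1), ℓ' * |g i - g' i| * (ω ^ (j - i) * env (fun _ => c * gIR) i j) :=
        dist_entry_le_env hℓ' hω (fun x hx _ => mul_nonneg hc hx.le) hD hdir hmem hg hg' hdom j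
    _ = ∑ i ∈ range (j + 1), ℓ' * ((1 + c * gIR) * ω) ^ (j - i) * |g i - g' i| := by
        refine Finset.sum_congr rfl fun i hi => ?_
        have hij : i ≤ j := Nat.lt_succ_iff.mp (mem_range.mp hi)
        rw [env_const _ hij, mul_pow]
        ring

end Pinned

end Literature.MathematicalPhysics.QuantumFieldTheory.Balaban1983to89.T4FlagMemoryAF
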